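import Literature.InformationTheory.Entanglement.MerminKlyshkoGHZ
import Literature.InformationTheory.Entanglement.SpinSqueezingCriterion
import HarnessLib

/-!
# The two-setting stabilizer witness for `N`-qubit GHZ entanglement (Tóth–Gühne 2005, Theorem 1)

Topic `Literature/InformationTheory/Entanglement`, companion of `GHZFidelityWitness.lean` (the
projector witness `𝟙/2 − |GHZ_N⟩⟨GHZ_N|`, `normSq_ghzN_overlap_le`, `IsBiseparable`) and of
`MerminKlyshkoGHZ.lean` (Pauli strings `pauliWord` on the register `Fin N → Bool`).  Sources
(held texts, read at the cited places):

* G. Tóth, O. Gühne, *Detecting Genuine Multipartite Entanglement with Two Local Measurements*,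
  Phys. Rev. Lett. 94, 060501 (2005) = arXiv:quant-ph/0405165 [TothGuhne2005], p. 2: “an
  `N`-qubit GHZ state, `|GHZ_N⟩ = (|0⟩^{⊗N} + |1⟩^{⊗N})/√2`. Its stabilizing operators are
  `S₁^{(GHZ_N)} := Π_{k=1}^N σ_x^{(k)}`, `S_k^{(GHZ_N)} := σ_z^{(k−1)} σ_z^{(k)}` for
  `k = 2, 3, …, N`”; **Theorem 1.** “The following entanglement witness detects genuine `N`-qubit
  entanglement for states close to an `N`-qubit GHZ state:
  `𝒲_{GHZ_N} := 3·𝟙 − 2[ (S₁^{(GHZ_N)} + 𝟙)/2 + Π_{k=2}^N (S_k^{(GHZ_N)} + 𝟙)/2 ]`.  Another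
  witness for this task is given by `𝒲′_{GHZ_N} := (N − 1)𝟙 − Σ_{k=1}^N S_k^{(GHZ_N)}`”;
  Proof: “First, we need to know that `𝒲̃_{GHZ_N} = 𝟙/2 − |GHZ_N⟩⟨GHZ_N|` detects genuine
  `N`-qubit entanglement … we have to show that `𝒲_{GHZ_N} − α𝒲̃_{GHZ_N} ≥ 0` where `α` is some
  positive constant. … Let us now look at the observable `X := 𝒲_{GHZ_N} − 2𝒲̃_{GHZ_N}` and show
  that `X ≥ 0`. We can express `X` in the GHZ state basis … the entries on the diagonal are all
  non-negative”; “The first term in the square bracket is a projector to the subspace where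
  `S₁^{(GHZ_N)} = +1`. The second one is a projector to subspace where `S_k^{(GHZ_N)} = +1` for all
  `k ∈ {2, 3, …, N}`. Clearly only a GHZ state gives `+1` for both projectors”; robustness: “It
  detects a state of the form `ϱ(p) = p_noise 𝟙/2^N + (1 − p_noise)|GHZ_N⟩⟨GHZ_N|` for
  `p_noise < 1/(3 − 4/2^N)` as true multipartite entangled thus it tolerates at least 33% noise,
  independent from the number of qubits. For `N = 3` … tolerates noise up to `p_noise < 0.4`”;
  p. 1: the sign convention “`Tr(ϱ𝒲̃) ≥ 0`” on all biseparable `ϱ`, detection = negative value.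
* G. Tóth, O. Gühne, *Entanglement detection in the stabilizer formalism*, Phys. Rev. A 72,
  022340 (2005) = arXiv:quant-ph/0501020 [TothGuhne2005Stabilizer], §II: “one may define the GHZ
  state also in the following way … `S_1^{(GHZ_N)} := Π_{k=1}^N X^{(k)}`,
  `S_k^{(GHZ_N)} := Z^{(k−1)}Z^{(k)}` for `k = 2, 3, …, N` … as the state `|GHZ_N⟩` which fulfills
  `S_k^{(GHZ_N)}|GHZ_N⟩ = |GHZ_N⟩` for `k = 1, 2, …, N`. One can straightforwardly calculate that
  these definitions are equivalent and the GHZ state is uniquely defined by [these equations]”;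
  **Theorem 4.** “For the Bell
  operator of the Mermin's inequality
  `M_N := 2^{−(N−1)} [X^{(1)}X^{(2)}X^{(3)}X^{(4)} ⋯ X^{(N)} − Y^{(1)}Y^{(2)}X^{(3)}X^{(4)} ⋯ X^{(N)}
  + Y^{(1)}Y^{(2)}Y^{(3)}Y^{(4)} ⋯ X^{(N)} − …]` the operator expectation value for biseparable
  states is bounded by `⟨M_N⟩ ≤ 1/2`, while the quantum maximum is `1`. Note that a term …
  represents the sum of all its possible permutations.  *Proof.* `M_N` can alternatively written as
  `M_N = S₁^{(GHZ_N)} Π_{k=2}^N (S_k^{(GHZ_N)} + 𝟙)/2 = |00…0⟩⟨11…1| + |11…1⟩⟨00…0|`. The maximum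
  for `⟨M_N⟩` for biseparable states can be obtained knowing
  `|GHZ_N⟩⟨GHZ_N| − M_N = |GHZ_N^−⟩⟨GHZ_N^−| ≥ 0`, where `|GHZ_N^−⟩ = (|0000…⟩ − |1111…⟩)/√2`.
  Hence for biseparable states `ϱ`: `⟨M_N⟩_ϱ ≤ ⟨|GHZ_N⟩⟨GHZ_N|⟩_ϱ ≤ 1/2`.”  §III.C (Obtaining the
  fidelity of the prepared state): “`|GHZ_N⟩⟨GHZ_N| ≥ ½ − ½𝒲_{GHZ_N}` … a lower bound on the fidelity
  `F := Tr(|GHZ_N⟩⟨GHZ_N|ρ)` can be obtained as `F' := Tr(P'ρ)` where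
  `P' := ½ − ½𝒲_{GHZ_N} = (S₁+𝟙)/2 + Π_{k=2}^N (S_k+𝟙)/2 − 𝟙`. Note that for measuring `P'` only
  two local measurement settings are needed. … For this state we have `F(p_noise) = 1 − p_noise(1 −
  2^{−N})`, `F'(p_noise) = 1 − p_noise(3/2 − 2^{−(N−1)})`. The difference is `ΔF ≈ p_noise/2` for
  large `N`.”
* O. Gühne, G. Tóth, Phys. Rep. 474 (2009) [GuhneToth2009], §3.6.2 eq. (73) (the projector
  witness) — formalised in `GHZFidelityWitness.lean`; §6.6.1 eqs. (137)–(138) (“the projector to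
  `|Ψ⟩` can be written as `|Ψ⟩⟨Ψ| = 2^{−N} Σ_k S_k = Π_{k=1}^N (𝟙 + g_k)/2`”, with
  “`g_1^{(GHZ_N)} := Π_k X_k`, `g_k^{(GHZ_N)} := Z_{k−1}Z_k`”) and eq. (141) (“`𝒲_Mermin := 2^{N−2}𝟙 −
  Σ_π X₁X₂X₃X₄⋯X_N + Σ_π Y₁Y₂X₃X₄⋯X_N − Σ_π Y₁Y₂Y₃Y₄X₅⋯X_N + … − …` … is just constructed from the
  Bell operator of the Mermin inequality … detects genuine multipartite entanglement … detects the
  noisy GHZ state as entangled if `p_noise < 1/2`”); §6.6.5 *Witnesses for full separability*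
  (PDF p. 54): “a product state cannot give +1 for two stabilizing operators that do not commute
  locally … a witness detecting entanglement around an N-qubit GHZ state can be obtained as
  `𝒲_m^{(GHZ_N)} := 𝟙 − g₁^{(GHZ_N)} − g_m^{(GHZ_N)}` (150) where `m = 2, 3, …, N`. The proof is
  based on the Cauchy-Schwarz inequality. Using this and `⟨X_i⟩² + ⟨Z_i⟩² ≤ 1`, we obtain for pure
  product states `⟨g₁⟩ + ⟨g_m⟩ = ⟨X₁⟩⟨X₂⟩…⟨X_N⟩ + ⟨Z_{m−1}⟩⟨Z_m⟩ ≤ |⟨X_{m−1}⟩|·|⟨X_m⟩| +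
  |⟨Z_{m−1}⟩|·|⟨Z_m⟩| ≤ √(⟨X_{m−1}⟩² + ⟨Z_{m−1}⟩²)√(⟨X_m⟩² + ⟨Z_m⟩²) ≤ 1` (151). By convexity, the
  bound is also valid for mixed separable states. … Witnesses can be constructed with more than two
  elements of the stabilizer as `𝒲̂_m^{(GHZ_N)} := 𝟙 − g₁ − g_m − g₁g_m` (152) for `m = 2, 3, …, N`
  that rule out full separability. … These witnesses tolerate noise if `p_noise < 1/2` and `2/3`,
  respectively.”  (Here `g₁ = S₁`, `g_m = S_m`.)

HONEST FRAMING (pub-qadeq lane — `N`-qubit GHZ ‘genuine multipartite entanglement’ milestones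
certified with TWO measurement settings, `σ_x^{⊗N}` and the computational basis): instance-level
adjudication of specific advantage claims; no claim about BQP vs BPP or the summit.  Nothing
here concerns devices or statistics.

## Contents (all proved, 0 named facts)

Register `Fin N → Bool`; for the chain `S_k = σ_z^{(k−1)}σ_z^{(k)}` the qubits are indexed
`Fin (n + 1)` (`N = n + 1`) and `k − 1 ↔ i.castSucc`, `k ↔ i.succ` for `i : Fin n`.

* **`stabX N`** `= S₁ = σ_x^{⊗N}` (a `pauliWord`), `stabX_apply` (`⟨y|S₁|x⟩ = [y = x̄]`),
  `vecState_stabX` (`⟨ψ|S₁|ψ⟩ = Re Σ_x ψ̄(x)ψ(x̄)`); **`stabZZ i`** `= σ_z^{(k−1)}σ_z^{(k)}` (a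
  `pauliWord`), `stabZZ_eq_diagonal` (`= diag((−1)^{x_{k−1} ⊕ x_k})`).
* **`projX`** `= (S₁ + 𝟙)/2`, **`projEq`** `= diag[x constant]` with the printed form
  **`projEq_eq_prod`** (`= Π_{k=2}^N (S_k + 𝟙)/2` as an operator product, `N ≥ 1`),
  `vecState_projEq` (`⟨ψ|·|ψ⟩ = |ψ(0…0)|² + |ψ(1…1)|²` = the populations `P`).
* **`tgWitness`** `= 𝒲_{GHZ_N} = 3·𝟙 − 2[projX + projEq]` (Theorem 1's operator);
  **`vecState_tgWitness_sub_proj`** — the key operator inequality made quantitative: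
  `⟨ψ|𝒲|ψ⟩ − 2⟨ψ|𝒲̃|ψ⟩ = ½ Σ_x |ψ(x) − ψ(x̄)|² − |ψ(0…0) − ψ(1…1)|² ≥ 0`
  (`vecState_tgWitness_ge`, the “`X ≥ 0`” of the proof); **`tothGuhne_theorem1_pure`** and
  **`tothGuhne_theorem1`**: `Tr(ϱ𝒲_{GHZ_N}) ≥ 0` for every biseparable `ϱ`, i.e.
  (**`stabX_add_two_populations_le_two`**) `⟨S₁⟩_ϱ + 2P ≤ 2` — so `⟨σ_x^{⊗N}⟩ + 2P > 2 ⟹ ϱ`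
  genuinely `N`-partite entangled (**`not_isBiseparable_of_two_lt`**); the GHZ value
  **`trState_tgWitness_ghz`** (`= −1`, both projectors give `+1`); the noise robustness
  **`trState_tgWitness_noisyGHZ`** (`Tr(𝒲ϱ(p)) = p(3 − 4/2^N) − 1`) and
  **`tgWitness_detects_noisyGHZ`** (negative iff `p < 1/(3 − 4/2^N)`).

* The second witness of Theorem 1, **`tgWitness' n`** `= 𝒲′_{GHZ_N} = (N−1)𝟙 − Σ_{k=1}^N S_k`
  (`N = n + 1`): `vecState_stabZZ`, `chainSigns` (`≤ N − 1`, `= N − 1` iff constant, `≤ N − 3`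
  otherwise), **`vecState_tgWitness'_ge`** (`X′ = 𝒲′ − 2𝒲̃ ≥ 0`), **`tothGuhne_theorem1'`**
  (`Tr(ϱ𝒲′) ≥ 0` on biseparable `ϱ`), **`stabilizer_sum_le`** (`⟨S₁⟩ + Σ_k⟨S_k⟩ ≤ N − 1`),
  `vecState_tgWitness'_ghzN` (`= −1`), `trace_stabZZ` (`= 0`), **`trState_tgWitness'_noisyGHZ`**
  (`= pN − 1`) and **`tgWitness'_detects_noisyGHZ`** (iff `p < 1/N`, as printed).

* (v2, section `FullSeparability`, imports `SpinSqueezingCriterion.lean` for `productVec`, `bloch`,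
  `bloch_sq_sum` and the FULLY separable states `SpinSqueezing.IsSeparable`) Gühne–Tóth (150)–(152)
  on `N = n + 1` qubits, pair `(m−1, m) = (i.castSucc, i.succ)`: `vecState_stabX_productVec`
  (`⟨g₁⟩ = Π⟨X_k⟩`), `vecState_stabZZ_productVec` (`⟨g_m⟩ = ⟨Z_{m−1}⟩⟨Z_m⟩`),
  `star_X_mulVec_dotProduct_Z_mulVec` (`⟨σ_xφ, σ_zφ⟩ = −i⟨σ_y⟩`), `vecState_stabX_mul_stabZZ_productVec`
  (`⟨g₁g_m⟩ = −⟨Y_{m−1}⟩⟨Y_m⟩Π_{k∉{m−1,m}}⟨X_k⟩`); the pure bounds **`stabX_add_stabZZ_productVec_le`**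
  ((151)) and **`stabX_add_stabZZ_add_prod_productVec_le`** (for (152), via
  `c² ≤ (1 − ⟨Z⟩²)(1 − ⟨Z′⟩²) ≤ (1 − ⟨Z⟩⟨Z′⟩)²`); the witnesses **`fullSepWitness i`** ((150)) and
  **`fullSepWitness' i`** ((152)); on fully separable `ϱ`: **`stabX_add_stabZZ_le_one`**
  (`⟨g₁⟩_ϱ + ⟨g_m⟩_ϱ ≤ 1`), `trState_fullSepWitness_nonneg`, **`not_isSeparable_of_one_lt`**,
  **`stabX_add_stabZZ_add_prod_le_one`**, `trState_fullSepWitness'_nonneg`; GHZ values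
  `stabZZ_mulVec_ghzN`, `vecState_stabX_mul_stabZZ_ghzN`, `trace_stabX_mul_stabZZ` (`= 0`); noise
  **`trState_fullSepWitness_noisyGHZ`** (`= 2p − 1`), **`fullSepWitness_detects_noisyGHZ`** (iff
  `p < 1/2`), **`trState_fullSepWitness'_noisyGHZ`** (`= 3p − 2`), **`fullSepWitness'_detects_noisyGHZ`**
  (iff `p < 2/3`), `not_isSeparable_noisyGHZ` (`p < 2/3 ⟹` not fully separable) — all as printed.

* (v3, section `MerminOperator`) Tóth–Gühne 2005 (PRA) **Theorem 4**: `yCount`, `merminCoeff s`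
  (`= Re(i^{#y}) = (i^{#y} + (−i)^{#y})/2`, **`merminCoeff_eq_ite`**: `(−1)^{#y/2}` for even `#y`, `0`
  for odd), **`merminOp N`** `= M_N = 2^{−(N−1)} Σ_s Re(i^{#y(s)}) O_s` (the printed
  `X⋯X − ΣYYX⋯X + ΣYYYYX⋯X − …`), `obsWord_apply_of_ne_flipAll` / `obsWord_apply_flipAll`,
  `sum_merminCoeff_mul_obsWord_flipAll` (generating function `Σ_s c^{#y}Π u = Π(1 + cu)`),
  **`merminOp_eq`** (`M_N = |0…0⟩⟨1…1| + |1…1⟩⟨0…0|`), **`merminOp_eq_stabX_mul_projEq`**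
  (`M_N = S₁ Π_k (S_k + 𝟙)/2` — “contains also only stabilizing terms”), **`vecState_merminOp`**
  (`⟨ψ|M_N|ψ⟩ = 2Re(ψ̄(0…0)ψ(1…1))`), **`trState_merminOp`** (`= Re(ϱ_{1…1,0…0} + ϱ_{0…0,1…1})`),
  **`ghzProj_sub_merminOp`** (`|GHZ_N⟩⟨GHZ_N| − M_N = |GHZ_N^−⟩⟨GHZ_N^−|`, `GHZ_N^− = ghzPhase N (−1)`),
  `vecState_merminOp_eq_sub` / `vecState_merminOp_le` (`⟨M_N⟩_ψ ≤ |⟨GHZ_N|ψ⟩|²`),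
  **`tothGuhne_theorem4`** (`Tr(ϱM_N) ≤ 1/2` on biseparable `ϱ`),
  **`not_isBiseparable_of_half_lt_merminOp`** (`⟨M_N⟩ > 1/2 ⟹` genuinely `N`-partite entangled),
  `vecState_merminOp_ghzN` / `trState_merminOp_ghz` (`= 1`, attained) and `vecState_merminOp_le_one`
  (the quantum maximum `1`).

* (v4, section `FidelityBound`) Tóth–Gühne 2005 (PRA) §III.C / Gühne–Tóth (148), the two-setting
  fidelity estimate: **`fidBound N`** `= P' = (S₁+𝟙)/2 + Π_k(S_k+𝟙)/2 − 𝟙` (`fidBound_eq`: `= ½𝟙 − ½𝒲_{GHZ_N}`),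
  `trState_fidBound` (in measured quantities), **`vecState_fidBound_le`** (`⟨ψ|P'|ψ⟩ ≤ |⟨GHZ_N|ψ⟩|²`,
  i.e. `|GHZ_N⟩⟨GHZ_N| ≥ P'`), **`trState_fidBound_le_ghzFidelity`** (`F ≥ F' = Tr(P'ϱ)` for every
  mixture of pure states), `trace_noisyGHZ`, **`trState_fidBound_noisyGHZ`** (`F'(p) = 1 − p(3/2 − 2^{−(N−1)})`),
  `noisyGHZ_eq_ghzWhiteNoise`, **`ghzFidelity_noisyGHZ`** (`F(p) = 1 − p(1 − 2^{−N})`),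
  **`ghzFidelity_sub_fidBound_noisyGHZ`** (`ΔF = p(½ − 2^{−N})`), `trState_fidBound_noisyGHZ_le`.
* (v5, section `Uniqueness`) Tóth–Gühne 2005 (PRA) §II “the GHZ state is uniquely defined by
  `S_k|GHZ_N⟩ = |GHZ_N⟩`” and Gühne–Tóth (137)–(138): `projX_mulVec_of_stabX`,
  `projEq_mulVec_of_stabZZ` (a common `+1` eigenvector of the `Z^{(k−1)}Z^{(k)}` is supported on the
  constant strings), **`projX_mul_projEq`** (`(S₁+𝟙)/2 · Π_{k≥2}(S_k+𝟙)/2 = |GHZ_N⟩⟨GHZ_N|`),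
  **`ghz_unique`** / **`ghz_unique_of_stabZZ`** (`S_kψ = ψ` for all `k ⟹ ψ = ⟨GHZ_N|ψ⟩|GHZ_N⟩`),
  `normSq_ghz_overlap_eq_one` (a unit common eigenvector has GHZ fidelity `1`).
* (v6, section `MerminWitness`) Gühne–Tóth (141): `sum_merminCoeff_smul_obsWord` (the word sum
  `= 2^{N−1}M_N`), **`merminWitness N`** `= 𝒲_Mermin = 2^{N−1}(½𝟙 − M_N)` with the printed form
  `merminWitness_eq_wordSum`, `trState_merminWitness`, **`merminWitness_nonneg_of_isBiseparable`**
  (detects only genuine `N`-partite entanglement, by Theorem 4), `merminOp_mulVec_ghzN`,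
  `trace_merminOp` (`= 0`), `trace_merminWitness`, **`trState_merminWitness_noisyGHZ`**
  (`= 2^{N−1}(p − ½)`), **`merminWitness_detects_noisyGHZ`** (iff `p < 1/2`, as printed).

NOT formalised: the cluster-state Theorem 2, optimality among two-setting stabilizer witnesses
[GT04], the general stabilizer-witness framework of the paper, the Mermin-operator full-separability
witness (153) (its constant comes from other references) and the cluster-state versions (154) (the
latter are in `GraphStateStabilizerWitness.lean`); Theorem 4's remark that “for fully separable
states the bound is lower” [R05].

## Mathlib / tree search

No stabilizer-witness material in Mathlib or the tree (`lean search 'stabiliz.*witness|TothGuhne'`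
empty; `StabilizerFidelityEstimation.lean` is direct fidelity estimation, a different statement).
Reused: `pauliWord` / `pauliWord_apply` (`MerminKlyshkoGHZ.lean`), `ket`, `constLabel`, `ghzN`,
`star_ghzN_dotProduct`, `IsBiseparablePure`, `IsBiseparable`, `populations`,
`normSq_ghzN_overlap_le_of_isBiseparablePure`, `vecState_vecMulVec` (`GHZFidelityWitness.lean`),
`vecState`, `trState` (`TsirelsonBound.lean`).
-/

namespace Literature.InformationTheory.Entanglement

namespace GHZStabilizerWitness

open Matrix Complex Finset
open Literature.Computability.QuantumComplexity
open Literature.InformationTheory.Entanglement.Tsirelson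
open GHZWitness MerminKlyshkoGHZ

variable {N : ℕ}

/-! ## The stabilizers `S₁ = σ_x^{⊗N}` and `S_k = σ_z^{(k−1)}σ_z^{(k)}` -/

/-- Flip every bit: `x̄`. [cite: TothGuhne2005, p. 2 (GHZ state basis)] -/
def flipAll (x : Fin N → Bool) : Fin N → Bool := fun j => !x j

/-- `x̄̄ = x` (`S₁² = 𝟙`). [cite: TothGuhne2005, p. 2 eq. (5)] -/
@[simp] theorem flipAll_flipAll (x : Fin N → Bool) : flipAll (flipAll x) = x := by
  funext j; simp [flipAll]

/-- The first GHZ stabilizer `S₁ = Π_{k=1}^N σ_x^{(k)}`. [cite: TothGuhne2005, p. 2 eq. (5)] -/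
noncomputable def stabX (N : ℕ) : Matrix (Fin N → Bool) (Fin N → Bool) ℂ :=
  pauliWord fun _ : Fin N => Pauli.X

/-- `⟨x|S₁|y⟩ = [y = x̄]`: `σ_x^{⊗N}` flips every bit. [cite: TothGuhne2005, p. 2 eq. (5)] -/
theorem stabX_apply (x y : Fin N → Bool) : stabX N x y = if y = flipAll x then 1 else 0 := by
  rw [stabX, pauliWord_apply]
  by_cases h : y = flipAll x
  · subst h
    rw [if_pos rfl]
    refine Finset.prod_eq_one fun j _ => ?_
    rw [Pauli.mat_X_apply, flipAll]
    cases x j <;> simp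
  · rw [if_neg h]
    have : ∃ j, y j = x j := by
      by_contra hall
      push Not at hall
      apply h
      funext j
      have hj := hall j
      rw [flipAll]
      cases hy : y j <;> cases hx : x j <;> simp_all
    obtain ⟨j, hj⟩ := this
    exact Finset.prod_eq_zero (Finset.mem_univ j) (by rw [Pauli.mat_X_apply, if_pos hj.symm])

/-- `S₁|ψ⟩ (x) = ψ(x̄)`. [cite: TothGuhne2005, p. 2 eq. (5)] -/
theorem stabX_mulVec (ψ : (Fin N → Bool) → ℂ) (x : Fin N → Bool) :
    (stabX N *ᵥ ψ) x = ψ (flipAll x) := by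
  rw [mulVec, dotProduct]
  simp_rw [stabX_apply]
  rw [Finset.sum_eq_single (flipAll x)]
  · rw [if_pos rfl, one_mul]
  · intro y _ hy; rw [if_neg hy, zero_mul]
  · intro h; exact absurd (Finset.mem_univ _) h

/-- `⟨ψ|S₁|ψ⟩ = Re Σ_x ψ̄(x) ψ(x̄)`. [cite: TothGuhne2005, p. 2 eq. (5)] -/
theorem vecState_stabX (ψ : (Fin N → Bool) → ℂ) :
    vecState ψ (stabX N) = (∑ x, star (ψ x) * ψ (flipAll x)).re := by
  rw [vecState_apply, dotProduct]
  simp_rw [Pi.star_apply, stabX_mulVec]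

/-- The chain stabilizers `S_k = σ_z^{(k−1)}σ_z^{(k)}`, `k = 2, …, N`: on `N = n + 1` qubits, for
`i : Fin n`, the Pauli string with `σ_z` at positions `i.castSucc` (= `k − 1`) and `i.succ` (= `k`)
and `𝟙` elsewhere. [cite: TothGuhne2005, p. 2 eq. (5)] -/
noncomputable def stabZZ {n : ℕ} (i : Fin n) : Matrix (Fin (n + 1) → Bool) (Fin (n + 1) → Bool) ℂ :=
  pauliWord fun j => if j = i.castSucc ∨ j = i.succ then Pauli.Z else Pauli.I

/-- `S_k = diag((−1)^{x_{k−1} ⊕ x_k})`: diagonal in the computational basis with entry `+1` where the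
two bits agree and `−1` where they differ. [cite: TothGuhne2005, p. 2 eq. (5)] -/
theorem stabZZ_eq_diagonal {n : ℕ} (i : Fin n) :
    stabZZ i = Matrix.diagonal fun x : Fin (n + 1) → Bool =>
      if x i.castSucc = x i.succ then (1 : ℂ) else -1 := by
  have hne : i.castSucc ≠ i.succ := Fin.castSucc_lt_succ.ne
  ext x y
  rw [stabZZ, pauliWord_apply, Matrix.diagonal_apply]
  by_cases hxy : x = y
  · subst hxy
    rw [if_pos rfl]
    have hfac : ∀ j, (if j = i.castSucc ∨ j = i.succ then Pauli.Z else Pauli.I).mat (x j) (x j) =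
        if j = i.castSucc ∨ j = i.succ then (if x j then -1 else 1) else 1 := by
      intro j
      by_cases h : j = i.castSucc ∨ j = i.succ
      · rw [if_pos h, if_pos h, Pauli.mat_Z_apply, if_pos rfl]
      · rw [if_neg h, if_neg h, Pauli.mat_I_apply, if_pos rfl]
    simp_rw [hfac]
    rw [Finset.prod_ite, Finset.prod_const_one, mul_one]
    have hfilter : (Finset.univ.filter fun j : Fin (n + 1) => j = i.castSucc ∨ j = i.succ) =
        {i.castSucc, i.succ} := by
      ext j; simp
    rw [hfilter, Finset.prod_pair hne]
    cases x i.castSucc <;> cases x i.succ <;> norm_num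
  · rw [if_neg hxy]
    have : ∃ j, x j ≠ y j := by
      by_contra hall; push Not at hall; exact hxy (funext hall)
    obtain ⟨j, hj⟩ := this
    refine Finset.prod_eq_zero (Finset.mem_univ j) ?_
    split_ifs <;> simp [hj]

/-! ## The two projectors of Theorem 1 -/

/-- `(S₁ + 𝟙)/2`, “a projector to the subspace where `S₁ = +1`”. [cite: TothGuhne2005, Theorem 1] -/
noncomputable def projX (N : ℕ) : Matrix (Fin N → Bool) (Fin N → Bool) ℂ :=
  (1 / 2 : ℝ) • (stabX N + 1)

/-- `Π_{k=2}^N (S_k + 𝟙)/2`, “a projector to subspace where `S_k = +1` for all `k ∈ {2, …, N}`”,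
i.e. onto the span of the constant strings `|0…0⟩, |1…1⟩`; defined as that diagonal projector
and identified with the printed operator product in `projEq_eq_prod`.
[cite: TothGuhne2005, Theorem 1] -/
noncomputable def projEq (N : ℕ) : Matrix (Fin N → Bool) (Fin N → Bool) ℂ :=
  Matrix.diagonal fun x => if (∀ i j, x i = x j) then (1 : ℂ) else 0

/-- A string is constant iff all consecutive bits agree. [folklore] -/
private theorem const_iff_chain {n : ℕ} (x : Fin (n + 1) → Bool) :
    (∀ i j, x i = x j) ↔ ∀ i : Fin n, x i.castSucc = x i.succ := by
  constructor
  · intro h i; exact h _ _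
  · intro h
    have h0 : ∀ j : Fin (n + 1), x j = x 0 := by
      intro j
      induction j using Fin.induction with
      | zero => rfl
      | succ i ih => rw [← h i, ih]
    intro i j; rw [h0 i, h0 j]

/-- An ordered product of diagonal matrices is the diagonal matrix of the pointwise products.
[folklore] -/
private theorem prod_ofFn_diagonal {m : ℕ} {ι : Type*} [Fintype ι] [DecidableEq ι]
    (d : Fin m → ι → ℂ) :
    (List.ofFn fun i => Matrix.diagonal (d i)).prod = Matrix.diagonal fun x => ∏ i, d i x := by
  induction m with
  | zero => simp
  | succ m ih =>
    rw [List.ofFn_succ, List.prod_cons, ih, Matrix.diagonal_mul_diagonal]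
    congr 1
    funext x
    rw [Fin.prod_univ_succ]

/-- `(S_k + 𝟙)/2 = diag[x_{k−1} = x_k]`. [cite: TothGuhne2005, Theorem 1 (“a projector to subspace
where S_k = +1”)] -/
theorem half_stabZZ_add_one {n : ℕ} (i : Fin n) :
    (1 / 2 : ℂ) • (stabZZ i + 1) =
      Matrix.diagonal fun x : Fin (n + 1) → Bool =>
        if x i.castSucc = x i.succ then (1 : ℂ) else 0 := by
  rw [stabZZ_eq_diagonal, ← Matrix.diagonal_one, Matrix.diagonal_add, ← Matrix.diagonal_smul]
  congr 1
  funext x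
  simp only [Pi.smul_apply, smul_eq_mul]
  split_ifs <;> norm_num

/-- **The printed form**: `projEq = Π_{k=2}^N (S_k + 𝟙)/2` as an (ordered) operator product of the
`N − 1` commuting diagonal projectors `(S_k + 𝟙)/2 = diag[x_{k−1} = x_k]` (`N = n + 1`).
[cite: TothGuhne2005, Theorem 1] -/
theorem projEq_eq_prod (n : ℕ) :
    projEq (n + 1) = (List.ofFn fun i : Fin n => (1 / 2 : ℂ) • (stabZZ i + 1)).prod := by
  simp_rw [half_stabZZ_add_one]
  rw [prod_ofFn_diagonal, projEq]
  congr 1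
  funext x
  rw [Finset.prod_boole]
  by_cases h : ∀ i : Fin n, x i.castSucc = x i.succ
  · rw [if_pos ((const_iff_chain x).2 h), if_pos fun i _ => h i]
  · rw [if_neg fun h' => h ((const_iff_chain x).1 h'),
      if_neg fun h' => h fun i => h' i (Finset.mem_univ _)]

/-- For `N ≥ 1` the constant strings are exactly `0…0` and `1…1`. [folklore] -/
private theorem const_iff_eq_constLabel [NeZero N] (x : Fin N → Bool) :
    (∀ i j, x i = x j) ↔ x = constLabel N false ∨ x = constLabel N true := by
  constructor
  · intro h
    cases h0 : x 0
    · left; funext j; rw [constLabel_apply, ← h0]; exact h j 0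
    · right; funext j; rw [constLabel_apply, ← h0]; exact h j 0
  · rintro (rfl | rfl) <;> intro i j <;> rfl

/-- `⟨ψ| Π_k (S_k + 𝟙)/2 |ψ⟩ = |ψ(0…0)|² + |ψ(1…1)|²` — the populations `P` of
`GHZFidelityWitness.populations` for `ϱ = |ψ⟩⟨ψ|` (`N ≥ 1`). [cite: TothGuhne2005, Theorem 1] -/
theorem vecState_projEq [NeZero N] (ψ : (Fin N → Bool) → ℂ) :
    vecState ψ (projEq N) =
      Complex.normSq (ψ (constLabel N false)) + Complex.normSq (ψ (constLabel N true)) := by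
  have hne := constLabel_false_ne_true (N := N)
  rw [vecState_apply, projEq, dotProduct]
  simp_rw [Matrix.mulVec_diagonal, Pi.star_apply]
  have hterm : ∀ x : Fin N → Bool, star (ψ x) * ((if (∀ i j, x i = x j) then (1 : ℂ) else 0) * ψ x) =
      if x = constLabel N false ∨ x = constLabel N true then ((Complex.normSq (ψ x) : ℝ) : ℂ)
        else 0 := by
    intro x
    by_cases hc : ∀ i j, x i = x j
    · rw [if_pos hc, if_pos ((const_iff_eq_constLabel x).1 hc), one_mul, Complex.star_def,
        Complex.normSq_eq_conj_mul_self]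
    · rw [if_neg hc, if_neg fun h => hc ((const_iff_eq_constLabel x).2 h), zero_mul, mul_zero]
  simp_rw [hterm]
  rw [← Finset.sum_filter]
  have hfilter : (Finset.univ.filter fun x : Fin N → Bool =>
      x = constLabel N false ∨ x = constLabel N true) = {constLabel N false, constLabel N true} := by
    ext x; simp
  rw [hfilter, Finset.sum_pair hne]
  simp only [Complex.add_re, Complex.ofReal_re]

/-- `⟨ψ|(S₁ + 𝟙)/2|ψ⟩ = ½(Re Σ_x ψ̄(x)ψ(x̄) + ⟨ψ|ψ⟩)`. [cite: TothGuhne2005, Theorem 1] -/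
theorem vecState_projX (ψ : (Fin N → Bool) → ℂ) :
    vecState ψ (projX N) =
      1 / 2 * ((∑ x, star (ψ x) * ψ (flipAll x)).re + (star ψ ⬝ᵥ ψ).re) := by
  rw [projX, map_smul, map_add, vecState_stabX, vecState_one, smul_eq_mul]

/-! ## The witness `𝒲_{GHZ_N}` of Theorem 1 -/

/-- **`𝒲_{GHZ_N} := 3·𝟙 − 2[(S₁ + 𝟙)/2 + Π_{k=2}^N (S_k + 𝟙)/2]`.** [cite: TothGuhne2005, Theorem 1
eq. (6)] -/
noncomputable def tgWitness (N : ℕ) : Matrix (Fin N → Bool) (Fin N → Bool) ℂ :=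
  (3 : ℝ) • (1 : Matrix (Fin N → Bool) (Fin N → Bool) ℂ) - (2 : ℝ) • (projX N + projEq N)

/-- `⟨ψ|𝒲|ψ⟩ = 3⟨ψ|ψ⟩ − 2(⟨ψ|projX|ψ⟩ + ⟨ψ|projEq|ψ⟩)`. [cite: TothGuhne2005, Theorem 1] -/
theorem vecState_tgWitness (ψ : (Fin N → Bool) → ℂ) :
    vecState ψ (tgWitness N) =
      3 * (star ψ ⬝ᵥ ψ).re - 2 * (vecState ψ (projX N) + vecState ψ (projEq N)) := by
  rw [tgWitness, map_sub, map_smul, map_smul, map_add, vecState_one, smul_eq_mul, smul_eq_mul]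

/-- `⟨ψ|ψ⟩ = Σ_x |ψ(x)|²`. [folklore] -/
private theorem star_dotProduct_self_re (ψ : (Fin N → Bool) → ℂ) :
    (star ψ ⬝ᵥ ψ).re = ∑ x, Complex.normSq (ψ x) := by
  rw [dotProduct, Complex.re_sum]
  refine Finset.sum_congr rfl fun x _ => ?_
  rw [Pi.star_apply, Complex.star_def, ← Complex.normSq_eq_conj_mul_self, Complex.ofReal_re]

/-- Bit flip is an involution of the register. [folklore] -/
private def flipEquiv (N : ℕ) : (Fin N → Bool) ≃ (Fin N → Bool) :=
  Function.Involutive.toPerm flipAll flipAll_flipAll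

/-- `Σ_x |ψ(x) − ψ(x̄)|² = 2Σ_x |ψ(x)|² − 2 Re Σ_x ψ̄(x)ψ(x̄)`. [folklore] -/
private theorem sum_normSq_sub_flip (ψ : (Fin N → Bool) → ℂ) :
    ∑ x, Complex.normSq (ψ x - ψ (flipAll x)) =
      2 * ∑ x, Complex.normSq (ψ x) - 2 * (∑ x, star (ψ x) * ψ (flipAll x)).re := by
  have hflip : ∑ x, Complex.normSq (ψ (flipAll x)) = ∑ x, Complex.normSq (ψ x) :=
    Fintype.sum_equiv (flipEquiv N) _ _ fun x => rfl
  have hre : ∀ x, (ψ x * (starRingEnd ℂ) (ψ (flipAll x))).re =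
      (star (ψ (flipAll x)) * ψ (flipAll (flipAll x))).re := by
    intro x
    rw [flipAll_flipAll, Complex.star_def, mul_comm]
  have hre' : ∑ x, (ψ x * (starRingEnd ℂ) (ψ (flipAll x))).re =
      ∑ x, (star (ψ x) * ψ (flipAll x)).re := by
    simp_rw [hre]
    exact Fintype.sum_equiv (flipEquiv N) _ _ fun x => rfl
  simp_rw [Complex.normSq_sub]
  rw [Finset.sum_sub_distrib, Finset.sum_add_distrib, hflip, ← Finset.mul_sum, hre',
    Complex.re_sum]
  ring

/-- `|⟨GHZ_N|ψ⟩|² = ½|ψ(0…0) + ψ(1…1)|²`. [cite: TothGuhne2005, Proof of Theorem 1] -/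
private theorem normSq_ghz_overlap (ψ : (Fin N → Bool) → ℂ) :
    Complex.normSq (star (ghzN N) ⬝ᵥ ψ) =
      1 / 2 * Complex.normSq (ψ (constLabel N false) + ψ (constLabel N true)) := by
  rw [star_ghzN_dotProduct, Complex.normSq_mul, Complex.normSq_ofReal, CHSHOpt.invSqrtTwo_mul_self]

/-- **The operator inequality of the proof, made quantitative** (`N ≥ 1`): for every vector `ψ`,
`⟨ψ|𝒲_{GHZ_N}|ψ⟩ − 2⟨ψ|𝒲̃_{GHZ_N}|ψ⟩ = ½ Σ_x |ψ(x) − ψ(x̄)|² − |ψ(0…0) − ψ(1…1)|²` where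
`𝒲̃ = 𝟙/2 − |GHZ_N⟩⟨GHZ_N|` (the `x = 0…0, 1…1` terms of the sum cancel the last term, so this is
`½ Σ_{x ≠ 0…0, 1…1} |ψ(x) − ψ(x̄)|²` — “`X` is diagonal in the GHZ state basis with non-negative
entries”). [cite: TothGuhne2005, Proof of Theorem 1] -/
theorem vecState_tgWitness_sub_proj [NeZero N] (ψ : (Fin N → Bool) → ℂ) :
    vecState ψ (tgWitness N) -
        2 * (1 / 2 * (star ψ ⬝ᵥ ψ).re - Complex.normSq (star (ghzN N) ⬝ᵥ ψ)) =
      1 / 2 * (∑ x, Complex.normSq (ψ x - ψ (flipAll x))) -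
        Complex.normSq (ψ (constLabel N false) - ψ (constLabel N true)) := by
  rw [vecState_tgWitness, vecState_projX, vecState_projEq, normSq_ghz_overlap,
    sum_normSq_sub_flip, star_dotProduct_self_re, Complex.normSq_add, Complex.normSq_sub]
  ring

/-- **`X = 𝒲 − 2𝒲̃ ≥ 0`** (`N ≥ 1`): `2(½⟨ψ|ψ⟩ − |⟨GHZ_N|ψ⟩|²) ≤ ⟨ψ|𝒲_{GHZ_N}|ψ⟩` for every `ψ`.
[cite: TothGuhne2005, Proof of Theorem 1 (“X := 𝒲 − 2𝒲̃ … X ≥ 0”)] -/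
theorem vecState_tgWitness_ge [NeZero N] (ψ : (Fin N → Bool) → ℂ) :
    2 * (1 / 2 * (star ψ ⬝ᵥ ψ).re - Complex.normSq (star (ghzN N) ⬝ᵥ ψ)) ≤
      vecState ψ (tgWitness N) := by
  have hne := constLabel_false_ne_true (N := N)
  have h := vecState_tgWitness_sub_proj ψ
  -- the two terms `x = 0…0` and `x = 1…1` of the non-negative sum already give `2|ψ₀ − ψ₁|²`
  have htwo : Complex.normSq (ψ (constLabel N false) - ψ (constLabel N true)) +
      Complex.normSq (ψ (constLabel N true) - ψ (constLabel N false)) ≤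
      ∑ x, Complex.normSq (ψ x - ψ (flipAll x)) := by
    have hsub : ({constLabel N false, constLabel N true} : Finset (Fin N → Bool)) ⊆ Finset.univ :=
      Finset.subset_univ _
    have hpair := Finset.sum_pair (f := fun x => Complex.normSq (ψ x - ψ (flipAll x))) hne
    have hle := Finset.sum_le_sum_of_subset_of_nonneg hsub
      (f := fun x => Complex.normSq (ψ x - ψ (flipAll x))) fun _ _ _ => Complex.normSq_nonneg _
    rw [hpair] at hle
    exact hle
  have hsymm : Complex.normSq (ψ (constLabel N true) - ψ (constLabel N false)) =
      Complex.normSq (ψ (constLabel N false) - ψ (constLabel N true)) := by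
    rw [← Complex.normSq_neg, neg_sub]
  linarith

/-- **Theorem 1, pure states**: `⟨ψ|𝒲_{GHZ_N}|ψ⟩ ≥ 0` for every biseparable pure `ψ` (`N ≥ 1`) —
from `X ≥ 0` and the projector witness (`GHZFidelityWitness.normSq_ghzN_overlap_le`).
[cite: TothGuhne2005, Theorem 1] -/
theorem tothGuhne_theorem1_pure [NeZero N] {ψ : (Fin N → Bool) → ℂ} (hψ : IsBiseparablePure ψ) :
    0 ≤ vecState ψ (tgWitness N) := by
  have h1 := normSq_ghzN_overlap_le_of_isBiseparablePure hψ
  have h2 := vecState_tgWitness_ge ψ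
  linarith

/-- `Tr(|ψ⟩⟨ψ| M) = ⟨ψ|M|ψ⟩` (real parts). [folklore] -/
private theorem trState_vecMulVec {ι : Type*} [Fintype ι] [DecidableEq ι] (ψ : ι → ℂ)
    (M : Matrix ι ι ℂ) : trState (vecMulVec ψ (star ψ)) M = vecState ψ M := by
  rw [trState_apply, vecState_apply, Matrix.trace_mul_comm, Matrix.mul_vecMulVec,
    Matrix.trace_vecMulVec, dotProduct_comm]

/-- `Tr((Σ p_i |ψ_i⟩⟨ψ_i|) M) = Σ p_i ⟨ψ_i|M|ψ_i⟩`. [folklore] -/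
private theorem trState_mixture {ι : Type*} [Fintype ι] {κ : Type*} [Fintype κ] [DecidableEq κ]
    (p : ι → ℝ) (ψ : ι → κ → ℂ) (M : Matrix κ κ ℂ) :
    trState (∑ i, (p i : ℂ) • vecMulVec (ψ i) (star (ψ i))) M = ∑ i, p i * vecState (ψ i) M := by
  rw [trState_apply, Finset.sum_mul, Matrix.trace_sum, Complex.re_sum]
  refine Finset.sum_congr rfl fun i _ => ?_
  rw [Matrix.smul_mul, Matrix.trace_smul, smul_eq_mul, Complex.re_ofReal_mul, ← trState_apply,
    trState_vecMulVec]

/-- **Theorem 1 (Tóth–Gühne 2005).**  `𝒲_{GHZ_N} = 3·𝟙 − 2[(S₁ + 𝟙)/2 + Π_{k=2}^N (S_k + 𝟙)/2]` is an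
entanglement witness for genuine `N`-qubit entanglement: `Tr(ϱ 𝒲_{GHZ_N}) ≥ 0` for every
biseparable `ϱ` (`N ≥ 1`). [cite: TothGuhne2005, Theorem 1] -/
theorem tothGuhne_theorem1 [NeZero N] {ρ : Matrix (Fin N → Bool) (Fin N → Bool) ℂ}
    (hρ : IsBiseparable ρ) : 0 ≤ trState ρ (tgWitness N) := by
  obtain ⟨ι, _, p, ψ, hp, -, -, hψ, rfl⟩ := hρ
  rw [trState_mixture]
  exact Finset.sum_nonneg fun i _ => mul_nonneg (hp i) (tothGuhne_theorem1_pure (hψ i))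

/-- A state detected by the witness (`Tr(ϱ𝒲) < 0`) is genuinely `N`-partite entangled.
[cite: TothGuhne2005, p. 1 (“`Tr(ϱ𝒲̃) ≥ 0`” on biseparable states) and Theorem 1] -/
theorem not_isBiseparable_of_trState_tgWitness_neg [NeZero N]
    {ρ : Matrix (Fin N → Bool) (Fin N → Bool) ℂ} (h : trState ρ (tgWitness N) < 0) :
    ¬ IsBiseparable ρ :=
  fun hρ => absurd h (not_lt.2 (tothGuhne_theorem1 hρ))

/-! ## The witness in measured quantities: `⟨S₁⟩ + 2P ≤ 2` -/

/-- `Tr(ϱ𝒲) = 3 Tr ϱ − 2(Tr(ϱ projX) + Tr(ϱ projEq))` (real parts). [cite: TothGuhne2005,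
Theorem 1] -/
theorem trState_tgWitness (ρ : Matrix (Fin N → Bool) (Fin N → Bool) ℂ) :
    trState ρ (tgWitness N) = 3 * ρ.trace.re - 2 * (trState ρ (projX N) + trState ρ (projEq N)) := by
  rw [tgWitness, map_sub, map_smul, map_smul, map_add, trState_one, smul_eq_mul, smul_eq_mul]

/-- `Tr(ϱ (S₁ + 𝟙)/2) = ½(Re Tr(ϱS₁) + Re Tr ϱ)`. [cite: TothGuhne2005, Theorem 1] -/
theorem trState_projX (ρ : Matrix (Fin N → Bool) (Fin N → Bool) ℂ) :
    trState ρ (projX N) = 1 / 2 * (trState ρ (stabX N) + ρ.trace.re) := by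
  rw [projX, map_smul, map_add, trState_one, smul_eq_mul]

/-- `Tr(ϱ Π_k(S_k + 𝟙)/2) = Re(ϱ_{0…0,0…0} + ϱ_{1…1,1…1}) = P`, the GHZ populations of
`GHZFidelityWitness.populations` (`N ≥ 1`). [cite: TothGuhne2005, Theorem 1; MonzEtAl2011, p. 2] -/
theorem trState_projEq [NeZero N] (ρ : Matrix (Fin N → Bool) (Fin N → Bool) ℂ) :
    trState ρ (projEq N) = populations ρ := by
  have hne := constLabel_false_ne_true (N := N)
  rw [trState_apply, populations, projEq, Matrix.trace]
  simp only [Matrix.diag_apply, Matrix.mul_diagonal]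
  have hterm : ∀ x : Fin N → Bool, ρ x x * (if (∀ i j, x i = x j) then (1 : ℂ) else 0) =
      if x = constLabel N false ∨ x = constLabel N true then ρ x x else 0 := by
    intro x
    by_cases hc : ∀ i j, x i = x j
    · rw [if_pos hc, if_pos ((const_iff_eq_constLabel x).1 hc), mul_one]
    · rw [if_neg hc, if_neg fun h => hc ((const_iff_eq_constLabel x).2 h), mul_zero]
  simp_rw [hterm]
  rw [← Finset.sum_filter]
  have hfilter : (Finset.univ.filter fun x : Fin N → Bool =>
      x = constLabel N false ∨ x = constLabel N true) = {constLabel N false, constLabel N true} := by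
    ext x; simp
  rw [hfilter, Finset.sum_pair hne]

/-- **Theorem 1 in measured quantities**: for every biseparable `ϱ` (`N ≥ 1`),
`⟨S₁⟩_ϱ + 2P ≤ 2`, where `⟨S₁⟩ = Re Tr(ϱ σ_x^{⊗N})` (one setting) and
`P = ϱ_{0…0,0…0} + ϱ_{1…1,1…1}` (the computational-basis setting). [cite: TothGuhne2005, Theorem 1
(“only two measurement settings are needed”)] -/
theorem stabX_add_two_populations_le_two [NeZero N] {ρ : Matrix (Fin N → Bool) (Fin N → Bool) ℂ}
    (hρ : IsBiseparable ρ) : trState ρ (stabX N) + 2 * populations ρ ≤ 2 := by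
  have htr := trace_eq_one_of_isBiseparable hρ
  have h := tothGuhne_theorem1 hρ
  rw [trState_tgWitness, trState_projX, trState_projEq, htr, Complex.one_re] at h
  linarith

/-- **The two-setting GME criterion**: `⟨σ_x^{⊗N}⟩_ϱ + 2P > 2 ⟹ ϱ` is genuinely `N`-partite
entangled. [cite: TothGuhne2005, Theorem 1] -/
theorem not_isBiseparable_of_two_lt [NeZero N] {ρ : Matrix (Fin N → Bool) (Fin N → Bool) ℂ}
    (h : 2 < trState ρ (stabX N) + 2 * populations ρ) : ¬ IsBiseparable ρ :=
  fun hρ => absurd h (not_lt.2 (stabX_add_two_populations_le_two hρ))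

/-! ## The GHZ value `−1` and the noise tolerance `p < 1/(3 − 4/2^N)` -/

/-- `S₁|GHZ_N⟩ = |GHZ_N⟩`. [cite: TothGuhne2005, p. 2 (“stabilizing operators”)] -/
theorem stabX_mulVec_ghzN : stabX N *ᵥ ghzN N = ghzN N := by
  funext x
  rw [stabX_mulVec, ghzN]
  simp only [Pi.smul_apply, Pi.add_apply, ket_apply]
  have h0 : (flipAll x = constLabel N false) ↔ (x = constLabel N true) := by
    constructor
    · intro h; rw [← flipAll_flipAll x, h]; rfl
    · intro h; rw [h]; rfl
  have h1 : (flipAll x = constLabel N true) ↔ (x = constLabel N false) := by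
    constructor
    · intro h; rw [← flipAll_flipAll x, h]; rfl
    · intro h; rw [h]; rfl
  simp only [h0, h1]
  rw [add_comm]

/-- `⟨GHZ_N|(S₁ + 𝟙)/2|GHZ_N⟩ = 1` (`N ≥ 1`). [cite: TothGuhne2005, Theorem 1 (“only a GHZ state
gives +1 for both projectors”)] -/
theorem vecState_projX_ghzN [NeZero N] : vecState (ghzN N) (projX N) = 1 := by
  rw [projX, map_smul, map_add, vecState_one, vecState_apply, stabX_mulVec_ghzN, ghzN_norm,
    smul_eq_mul, Complex.one_re]
  norm_num

/-- `⟨GHZ_N|Π_k(S_k + 𝟙)/2|GHZ_N⟩ = 1` (`N ≥ 1`). [cite: TothGuhne2005, Theorem 1 (“only a GHZ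
state gives +1 for both projectors”)] -/
theorem vecState_projEq_ghzN [NeZero N] : vecState (ghzN N) (projEq N) = 1 := by
  have hne := constLabel_false_ne_true (N := N)
  rw [vecState_projEq, ghzN]
  simp only [Pi.smul_apply, Pi.add_apply, ket_self, ket_of_ne hne, ket_of_ne (Ne.symm hne),
    smul_eq_mul, add_zero, zero_add, mul_one, Complex.normSq_ofReal, CHSHOpt.invSqrtTwo_mul_self]
  norm_num

/-- **`⟨GHZ_N|𝒲_{GHZ_N}|GHZ_N⟩ = −1`** (`N ≥ 1`): the GHZ state is detected.
[cite: TothGuhne2005, Theorem 1] -/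
theorem vecState_tgWitness_ghzN [NeZero N] : vecState (ghzN N) (tgWitness N) = -1 := by
  rw [vecState_tgWitness, vecState_projX_ghzN, vecState_projEq_ghzN, ghzN_norm, Complex.one_re]
  norm_num

/-- `Tr(|GHZ_N⟩⟨GHZ_N| 𝒲) = −1` (`N ≥ 1`). [cite: TothGuhne2005, Theorem 1] -/
theorem trState_tgWitness_ghz [NeZero N] :
    trState (vecMulVec (ghzN N) (star (ghzN N))) (tgWitness N) = -1 := by
  rw [trState_vecMulVec, vecState_tgWitness_ghzN]

/-- `Tr S₁ = 0` (`N ≥ 1`): no string is its own flip. [cite: TothGuhne2005, p. 3 (noise-tolerance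
computation with `𝟙/2^N`)] -/
theorem trace_stabX [NeZero N] : (stabX N).trace = 0 := by
  rw [Matrix.trace]
  refine Finset.sum_eq_zero fun x _ => ?_
  rw [Matrix.diag_apply, stabX_apply, if_neg]
  intro h
  have := congrFun h 0
  simp [flipAll] at this

/-- `Tr Π_k(S_k + 𝟙)/2 = 2` (`N ≥ 1`): the two constant strings. [cite: TothGuhne2005, p. 3
(noise-tolerance computation)] -/
theorem trace_projEq [NeZero N] : (projEq N).trace = 2 := by
  have hne := constLabel_false_ne_true (N := N)
  rw [projEq, Matrix.trace]
  simp only [Matrix.diag_apply, Matrix.diagonal_apply_eq]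
  simp_rw [const_iff_eq_constLabel]
  rw [Finset.sum_boole]
  have hfilter : (Finset.univ.filter fun x : Fin N → Bool =>
      x = constLabel N false ∨ x = constLabel N true) = {constLabel N false, constLabel N true} := by
    ext x; simp
  rw [hfilter, Finset.card_pair hne]
  norm_num

/-- `Tr 𝟙 = 2^N` on the `N`-qubit register (the `𝟙/2^N` of `ϱ(p)`). [cite: TothGuhne2005, p. 3
eq. (8)] -/
theorem trace_one_register : (1 : Matrix (Fin N → Bool) (Fin N → Bool) ℂ).trace = 2 ^ N := by
  rw [Matrix.trace_one, Fintype.card_fun, Fintype.card_bool, Fintype.card_fin]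
  norm_num

/-- **`Tr 𝒲_{GHZ_N} = 2·2^N − 4`** (`N ≥ 1`; `Tr projX = 2^{N−1}`, `Tr projEq = 2`).
[cite: TothGuhne2005, p. 3 (noise tolerance computation)] -/
theorem trace_tgWitness [NeZero N] : (tgWitness N).trace = 2 * 2 ^ N - 4 := by
  rw [tgWitness, Matrix.trace_sub, Matrix.trace_smul, Matrix.trace_smul, Matrix.trace_add, projX,
    Matrix.trace_smul, Matrix.trace_add, trace_stabX, trace_projEq, trace_one_register]
  simp only [Complex.real_smul]
  push_cast
  ring

/-- The noisy GHZ state `ϱ(p) = p·𝟙/2^N + (1 − p)|GHZ_N⟩⟨GHZ_N|`. [cite: TothGuhne2005, p. 3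
eq. (8)] -/
noncomputable def noisyGHZ (N : ℕ) (p : ℝ) : Matrix (Fin N → Bool) (Fin N → Bool) ℂ :=
  ((p / 2 ^ N : ℝ) : ℂ) • (1 : Matrix (Fin N → Bool) (Fin N → Bool) ℂ) +
    ((1 - p : ℝ) : ℂ) • vecMulVec (ghzN N) (star (ghzN N))

/-- **`Tr(𝒲_{GHZ_N} ϱ(p)) = p(3 − 4/2^N) − 1`** (`N ≥ 1`). [cite: TothGuhne2005, p. 3 (“detects
… ϱ(p) … for p_noise < 1/(3 − 4/2^N)”)] -/
theorem trState_tgWitness_noisyGHZ [NeZero N] (p : ℝ) :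
    trState (noisyGHZ N p) (tgWitness N) = p * (3 - 4 / 2 ^ N) - 1 := by
  have hG := trState_tgWitness_ghz (N := N)
  rw [trState_apply] at hG
  rw [trState_apply, noisyGHZ, Matrix.add_mul, Matrix.smul_mul, Matrix.smul_mul, Matrix.one_mul,
    Matrix.trace_add, Matrix.trace_smul, Matrix.trace_smul, trace_tgWitness, smul_eq_mul,
    smul_eq_mul, Complex.add_re, Complex.re_ofReal_mul, Complex.re_ofReal_mul, hG]
  have h2 : ((2 : ℂ) * 2 ^ N - 4).re = 2 * 2 ^ N - 4 := by
    have : ((2 : ℂ) * 2 ^ N - 4) = ((2 * 2 ^ N - 4 : ℝ) : ℂ) := by push_cast; ring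
    rw [this, Complex.ofReal_re]
  rw [h2]
  have hpos : (2 : ℝ) ^ N ≠ 0 := pow_ne_zero _ two_ne_zero
  field_simp
  ring

/-- **Noise tolerance**: `ϱ(p)` is detected (`Tr(𝒲ϱ(p)) < 0`) exactly when `p < 1/(3 − 4/2^N)` —
“at least 33% noise, independent from the number of qubits” (`N ≥ 1`; for `N = 3` the bound is
`0.4`). [cite: TothGuhne2005, p. 3] -/
theorem tgWitness_detects_noisyGHZ [NeZero N] (p : ℝ) :
    trState (noisyGHZ N p) (tgWitness N) < 0 ↔ p < 1 / (3 - 4 / 2 ^ N) := by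
  rw [trState_tgWitness_noisyGHZ]
  have h2N : (2 : ℝ) ≤ 2 ^ N := by
    calc (2 : ℝ) = 2 ^ 1 := (pow_one _).symm
      _ ≤ 2 ^ N := pow_le_pow_right₀ (by norm_num) (Nat.one_le_iff_ne_zero.mpr (NeZero.ne N))
  have hpos : 0 < 3 - 4 / (2 : ℝ) ^ N := by
    have : 4 / (2 : ℝ) ^ N ≤ 2 := by
      rw [div_le_iff₀ (by positivity)]; linarith
    linarith
  rw [lt_div_iff₀ hpos]
  constructor <;> intro h <;> linarith

/-- The three-qubit tolerance: `1/(3 − 4/2³) = 0.4` (“tolerates noise up to p_noise < 0.4”).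
[cite: TothGuhne2005, p. 3] -/
theorem noise_tolerance_three : (1 : ℝ) / (3 - 4 / 2 ^ 3) = 0.4 := by norm_num

/-- The tolerance is at least `1/3` for every `N ≥ 1` (“at least 33% noise, independent from the
number of qubits”). [cite: TothGuhne2005, p. 3] -/
theorem one_third_le_noise_tolerance [NeZero N] : (1 : ℝ) / 3 ≤ 1 / (3 - 4 / 2 ^ N) := by
  have h2N : (2 : ℝ) ≤ 2 ^ N := by
    calc (2 : ℝ) = 2 ^ 1 := (pow_one _).symm
      _ ≤ 2 ^ N := pow_le_pow_right₀ (by norm_num) (Nat.one_le_iff_ne_zero.mpr (NeZero.ne N))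
  have h4 : (4 : ℝ) / 2 ^ N ≤ 2 := by
    rw [div_le_iff₀ (by positivity)]; linarith
  have hnn : (0 : ℝ) ≤ 4 / 2 ^ N := by positivity
  rw [div_le_div_iff₀ (by norm_num) (by linarith)]
  linarith

/-! ## The second witness `𝒲′_{GHZ_N} = (N − 1)𝟙 − Σ_{k=1}^N S_k` -/

section SecondWitness

variable {n : ℕ}

/-- `⟨ψ|S_k|ψ⟩ = Σ_x |ψ(x)|²·(±1)` (`+` where `x_{k−1} = x_k`). [cite: TothGuhne2005, p. 2 eq. (5)] -/
theorem vecState_stabZZ (i : Fin n) (ψ : (Fin (n + 1) → Bool) → ℂ) :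
    vecState ψ (stabZZ i) =
      ∑ x, Complex.normSq (ψ x) * (if x i.castSucc = x i.succ then (1 : ℝ) else -1) := by
  rw [vecState_apply, stabZZ_eq_diagonal, dotProduct, Complex.re_sum]
  refine Finset.sum_congr rfl fun x _ => ?_
  rw [Matrix.mulVec_diagonal, Pi.star_apply, Complex.star_def]
  split_ifs
  · rw [one_mul, ← Complex.normSq_eq_conj_mul_self, Complex.ofReal_re, mul_one]
  · rw [neg_one_mul, mul_neg, Complex.neg_re, ← Complex.normSq_eq_conj_mul_self,
      Complex.ofReal_re]
    ring

/-- The sum of the `N − 1` chain signs of a string: `Σ_{k=2}^N (−1)^{x_{k−1} ⊕ x_k}`. [folklore] -/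
def chainSigns (x : Fin (n + 1) → Bool) : ℝ :=
  ∑ i : Fin n, (if x i.castSucc = x i.succ then (1 : ℝ) else -1)

/-- `Σ_k (±1) ≤ N − 1`. [cite: TothGuhne2005, Theorem 1 (the `N − 1` of `𝒲′`)] -/
theorem chainSigns_le (x : Fin (n + 1) → Bool) : chainSigns x ≤ n := by
  unfold chainSigns
  calc ∑ i : Fin n, (if x i.castSucc = x i.succ then (1 : ℝ) else -1) ≤ ∑ _i : Fin n, (1 : ℝ) :=
        Finset.sum_le_sum fun i _ => by split_ifs <;> norm_num
    _ = n := by simp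

/-- A constant string has all `N − 1` chain signs `+1` (“only a GHZ state gives +1 for both
projectors”). [cite: TothGuhne2005, Theorem 1] -/
theorem chainSigns_of_const {x : Fin (n + 1) → Bool} (h : ∀ i j, x i = x j) : chainSigns x = n := by
  unfold chainSigns
  rw [Finset.sum_congr rfl fun i _ => if_pos (h i.castSucc i.succ)]
  simp

/-- A non-constant string has a disagreeing neighbour pair, so `Σ_k (±1) ≤ N − 3`.
[cite: TothGuhne2005, Proof of Theorem 1 (“X is diagonal in the GHZ state basis”)] -/
theorem chainSigns_le_of_not_const {x : Fin (n + 1) → Bool} (h : ¬ ∀ i j, x i = x j) :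
    chainSigns x ≤ n - 2 := by
  rw [const_iff_chain] at h
  push Not at h
  obtain ⟨i₀, hi₀⟩ := h
  unfold chainSigns
  rw [← Finset.add_sum_erase _ _ (Finset.mem_univ i₀), if_neg hi₀]
  have hrest : ∑ i ∈ Finset.univ.erase i₀, (if x i.castSucc = x i.succ then (1 : ℝ) else -1) ≤
      ∑ _i ∈ Finset.univ.erase i₀, (1 : ℝ) :=
    Finset.sum_le_sum fun i _ => by split_ifs <;> norm_num
  rw [Finset.sum_const, Finset.card_erase_of_mem (Finset.mem_univ _), Finset.card_univ,
    Fintype.card_fin, nsmul_eq_mul, mul_one] at hrest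
  have hn : 1 ≤ n := Nat.one_le_iff_ne_zero.mpr (Fin.pos i₀).ne' |> id
  rw [Nat.cast_sub hn, Nat.cast_one] at hrest
  linarith

/-- `⟨ψ| Σ_{k=2}^N S_k |ψ⟩ = Σ_x |ψ(x)|² · chainSigns(x)`. [cite: TothGuhne2005, Theorem 1 (𝒲′)] -/
theorem vecState_sum_stabZZ (ψ : (Fin (n + 1) → Bool) → ℂ) :
    vecState ψ (∑ i : Fin n, stabZZ i) = ∑ x, Complex.normSq (ψ x) * chainSigns x := by
  rw [map_sum]
  simp_rw [vecState_stabZZ, chainSigns, Finset.mul_sum]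
  rw [Finset.sum_comm]

/-- **`𝒲′_{GHZ_N} := (N − 1)𝟙 − Σ_{k=1}^N S_k`** on `N = n + 1` qubits. [cite: TothGuhne2005,
Theorem 1 eq. (7)] -/
noncomputable def tgWitness' (n : ℕ) : Matrix (Fin (n + 1) → Bool) (Fin (n + 1) → Bool) ℂ :=
  (n : ℝ) • (1 : Matrix (Fin (n + 1) → Bool) (Fin (n + 1) → Bool) ℂ) -
    (stabX (n + 1) + ∑ i : Fin n, stabZZ i)

/-- `⟨ψ|𝒲′|ψ⟩ = (N−1)⟨ψ|ψ⟩ − ⟨ψ|S₁|ψ⟩ − Σ_x |ψ(x)|² chainSigns(x)`. [cite: TothGuhne2005, Theorem 1] -/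
theorem vecState_tgWitness' (ψ : (Fin (n + 1) → Bool) → ℂ) :
    vecState ψ (tgWitness' n) =
      n * (star ψ ⬝ᵥ ψ).re - (vecState ψ (stabX (n + 1)) + ∑ x, Complex.normSq (ψ x) * chainSigns x) := by
  rw [tgWitness', map_sub, map_smul, map_add, vecState_one, vecState_sum_stabZZ, smul_eq_mul]

/-- **`X′ = 𝒲′ − 2𝒲̃ ≥ 0`**: `2(½⟨ψ|ψ⟩ − |⟨GHZ_N|ψ⟩|²) ≤ ⟨ψ|𝒲′_{GHZ_N}|ψ⟩` for every `ψ`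
(non-constant strings have `chainSigns ≤ N − 3`, which leaves the same non-negative quantity
`½Σ_{x ≠ 0…0,1…1}|ψ(x) − ψ(x̄)|²` as for `𝒲`). [cite: TothGuhne2005, Proof of Theorem 1 (“For the
other witness one can show similarly that 𝒲′ − 2𝒲̃ ≥ 0”)] -/
theorem vecState_tgWitness'_ge (ψ : (Fin (n + 1) → Bool) → ℂ) :
    2 * (1 / 2 * (star ψ ⬝ᵥ ψ).re - Complex.normSq (star (ghzN (n + 1)) ⬝ᵥ ψ)) ≤
      vecState ψ (tgWitness' n) := by
  have hne := constLabel_false_ne_true (N := n + 1)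
  -- the bound on the chain-sign term: `Σ_x |ψ_x|² σ(x) ≤ n·S − 2·(S − |ψ₀|² − |ψ₁|²)`
  have hsigma : ∀ x : Fin (n + 1) → Bool, Complex.normSq (ψ x) * chainSigns x ≤
      Complex.normSq (ψ x) * ((n : ℝ) - 2 + 2 * (if x = constLabel (n + 1) false ∨
        x = constLabel (n + 1) true then (1 : ℝ) else 0)) := by
    intro x
    refine mul_le_mul_of_nonneg_left ?_ (Complex.normSq_nonneg _)
    by_cases hc : ∀ i j, x i = x j
    · rw [chainSigns_of_const hc, if_pos ((const_iff_eq_constLabel x).1 hc)]; linarith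
    · rw [if_neg fun h => hc ((const_iff_eq_constLabel x).2 h)]
      have := chainSigns_le_of_not_const hc
      linarith
  have hsum : ∑ x, Complex.normSq (ψ x) * chainSigns x ≤
      ((n : ℝ) - 2) * ∑ x, Complex.normSq (ψ x) +
        2 * (Complex.normSq (ψ (constLabel (n + 1) false)) +
          Complex.normSq (ψ (constLabel (n + 1) true))) := by
    refine (Finset.sum_le_sum fun x _ => hsigma x).trans ?_
    have hind : ∑ x, Complex.normSq (ψ x) *
        (if x = constLabel (n + 1) false ∨ x = constLabel (n + 1) true then (1 : ℝ) else 0) =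
        Complex.normSq (ψ (constLabel (n + 1) false)) +
          Complex.normSq (ψ (constLabel (n + 1) true)) := by
      simp_rw [mul_ite, mul_one, mul_zero]
      rw [← Finset.sum_filter]
      have hfilter : (Finset.univ.filter fun x : Fin (n + 1) → Bool =>
          x = constLabel (n + 1) false ∨ x = constLabel (n + 1) true) =
          {constLabel (n + 1) false, constLabel (n + 1) true} := by
        ext x; simp
      rw [hfilter, Finset.sum_pair hne]
    rw [← hind, Finset.mul_sum, Finset.mul_sum, ← Finset.sum_add_distrib]
    refine le_of_eq (Finset.sum_congr rfl fun x _ => ?_)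
    ring
  -- the `𝒲` quantities
  have hD := sum_normSq_sub_flip ψ
  have hS := star_dotProduct_self_re ψ
  have hX := vecState_stabX (N := n + 1) ψ
  have hG := normSq_ghz_overlap ψ
  have htwo : Complex.normSq (ψ (constLabel (n + 1) false) - ψ (constLabel (n + 1) true)) +
      Complex.normSq (ψ (constLabel (n + 1) true) - ψ (constLabel (n + 1) false)) ≤
      ∑ x, Complex.normSq (ψ x - ψ (flipAll x)) := by
    have hsub : ({constLabel (n + 1) false, constLabel (n + 1) true} :
        Finset (Fin (n + 1) → Bool)) ⊆ Finset.univ := Finset.subset_univ _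
    have hpair := Finset.sum_pair (f := fun x => Complex.normSq (ψ x - ψ (flipAll x))) hne
    have hle := Finset.sum_le_sum_of_subset_of_nonneg hsub
      (f := fun x => Complex.normSq (ψ x - ψ (flipAll x))) fun _ _ _ => Complex.normSq_nonneg _
    rw [hpair] at hle
    exact hle
  have hsymm : Complex.normSq (ψ (constLabel (n + 1) true) - ψ (constLabel (n + 1) false)) =
      Complex.normSq (ψ (constLabel (n + 1) false) - ψ (constLabel (n + 1) true)) := by
    rw [← Complex.normSq_neg, neg_sub]
  have hpar := Complex.normSq_add (ψ (constLabel (n + 1) false)) (ψ (constLabel (n + 1) true))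
  have hpar' := Complex.normSq_sub (ψ (constLabel (n + 1) false)) (ψ (constLabel (n + 1) true))
  rw [vecState_tgWitness', hX, hG, hS]
  linarith [hsum, htwo, hsymm, hpar, hpar', hD]

/-- **Theorem 1 for `𝒲′`, pure states**: `⟨ψ|𝒲′_{GHZ_N}|ψ⟩ ≥ 0` for biseparable pure `ψ`.
[cite: TothGuhne2005, Theorem 1] -/
theorem tothGuhne_theorem1'_pure {ψ : (Fin (n + 1) → Bool) → ℂ} (hψ : IsBiseparablePure ψ) :
    0 ≤ vecState ψ (tgWitness' n) := by
  have h1 := normSq_ghzN_overlap_le_of_isBiseparablePure hψ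
  have h2 := vecState_tgWitness'_ge ψ
  linarith

/-- **Theorem 1 for `𝒲′` (Tóth–Gühne 2005)**: `Tr(ϱ 𝒲′_{GHZ_N}) ≥ 0` for every biseparable `ϱ`.
[cite: TothGuhne2005, Theorem 1] -/
theorem tothGuhne_theorem1' {ρ : Matrix (Fin (n + 1) → Bool) (Fin (n + 1) → Bool) ℂ}
    (hρ : IsBiseparable ρ) : 0 ≤ trState ρ (tgWitness' n) := by
  obtain ⟨ι, _, p, ψ, hp, -, -, hψ, rfl⟩ := hρ
  rw [trState_mixture]
  exact Finset.sum_nonneg fun i _ => mul_nonneg (hp i) (tothGuhne_theorem1'_pure (hψ i))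

/-- **`𝒲′` in measured quantities**: for every biseparable `ϱ` on `N = n + 1` qubits,
`⟨S₁⟩_ϱ + Σ_{k=2}^N ⟨S_k⟩_ϱ ≤ N − 1` (all `N` stabilizer generators cannot simultaneously be close
to `+1`). [cite: TothGuhne2005, Theorem 1 eq. (7)] -/
theorem stabilizer_sum_le {ρ : Matrix (Fin (n + 1) → Bool) (Fin (n + 1) → Bool) ℂ}
    (hρ : IsBiseparable ρ) :
    trState ρ (stabX (n + 1)) + ∑ i : Fin n, trState ρ (stabZZ i) ≤ n := by
  have htr := trace_eq_one_of_isBiseparable hρ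
  have h := tothGuhne_theorem1' hρ
  rw [tgWitness', map_sub, map_smul, map_add, map_sum, trState_one, htr, Complex.one_re,
    smul_eq_mul, mul_one] at h
  linarith

/-- `S_k|GHZ_N⟩ = |GHZ_N⟩` in expectation: `⟨GHZ_N|S_k|GHZ_N⟩ = 1`. [cite: TothGuhne2005, p. 2
(“stabilizing operators”)] -/
theorem vecState_stabZZ_ghzN (i : Fin n) : vecState (ghzN (n + 1)) (stabZZ i) = 1 := by
  have hne := constLabel_false_ne_true (N := n + 1)
  rw [vecState_stabZZ]
  have hterm : ∀ x : Fin (n + 1) → Bool, Complex.normSq (ghzN (n + 1) x) *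
      (if x i.castSucc = x i.succ then (1 : ℝ) else -1) =
      if x = constLabel (n + 1) false ∨ x = constLabel (n + 1) true then 1 / 2 else 0 := by
    intro x
    by_cases hx : x = constLabel (n + 1) false ∨ x = constLabel (n + 1) true
    · rw [if_pos hx]
      rcases hx with rfl | rfl <;>
        simp [ghzN, ket_apply, hne, hne.symm, Complex.normSq_ofReal, CHSHOpt.invSqrtTwo_mul_self]
    · rw [if_neg hx]
      push Not at hx
      simp [ghzN, ket_apply, hx.1, hx.2]
  simp_rw [hterm]
  rw [← Finset.sum_filter]
  have hfilter : (Finset.univ.filter fun x : Fin (n + 1) → Bool =>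
      x = constLabel (n + 1) false ∨ x = constLabel (n + 1) true) =
      {constLabel (n + 1) false, constLabel (n + 1) true} := by
    ext x; simp
  rw [hfilter, Finset.sum_pair hne]
  norm_num

/-- **`⟨GHZ_N|𝒲′_{GHZ_N}|GHZ_N⟩ = −1`**: all `N` generators take the value `+1` on the GHZ state.
[cite: TothGuhne2005, Theorem 1] -/
theorem vecState_tgWitness'_ghzN : vecState (ghzN (n + 1)) (tgWitness' n) = -1 := by
  rw [tgWitness', map_sub, map_smul, map_add, map_sum, vecState_one, ghzN_norm, Complex.one_re,
    vecState_apply, stabX_mulVec_ghzN, ghzN_norm, Complex.one_re, smul_eq_mul, mul_one]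
  simp_rw [vecState_stabZZ_ghzN]
  simp

/-- Flipping the prefix `j ≤ i.castSucc` of a string changes exactly the `i`-th chain sign.
[folklore] -/
private def prefixFlip (i : Fin n) (x : Fin (n + 1) → Bool) : Fin (n + 1) → Bool :=
  fun j => if j ≤ i.castSucc then !x j else x j

/-- The prefix flip is an involution. [folklore] -/
private theorem prefixFlip_prefixFlip (i : Fin n) (x : Fin (n + 1) → Bool) :
    prefixFlip i (prefixFlip i x) = x := by
  funext j; unfold prefixFlip; split_ifs <;> simp

/-- `Tr S_k = 0`: as many strings agree as disagree at the pair `(k − 1, k)`.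
[cite: TothGuhne2005, p. 3 (noise tolerance `1/N` of `𝒲′`)] -/
theorem trace_stabZZ (i : Fin n) : (stabZZ i).trace = 0 := by
  rw [stabZZ_eq_diagonal, Matrix.trace_diagonal]
  -- pair the strings by the prefix flip, which negates the `i`-th sign
  have hneg : ∀ x : Fin (n + 1) → Bool,
      (if prefixFlip i x i.castSucc = prefixFlip i x i.succ then (1 : ℂ) else -1) =
      -(if x i.castSucc = x i.succ then (1 : ℂ) else -1) := by
    intro x
    have h1 : prefixFlip i x i.castSucc = !x i.castSucc := by simp [prefixFlip]
    have h2 : prefixFlip i x i.succ = x i.succ := by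
      simp [prefixFlip, Fin.le_def]
    rw [h1, h2]
    cases x i.castSucc <;> cases x i.succ <;> simp
  have hsum : ∑ x : Fin (n + 1) → Bool, (if x i.castSucc = x i.succ then (1 : ℂ) else -1) =
      ∑ x : Fin (n + 1) → Bool, -(if x i.castSucc = x i.succ then (1 : ℂ) else -1) := by
    rw [← Equiv.sum_comp (Function.Involutive.toPerm (prefixFlip i) (prefixFlip_prefixFlip i))]
    simp only [Function.Involutive.coe_toPerm]
    exact Finset.sum_congr rfl fun x _ => hneg x
  rw [Finset.sum_neg_distrib] at hsum
  linear_combination (1 / 2 : ℂ) * hsum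

/-- **`Tr 𝒲′_{GHZ_N} = (N − 1)2^N`** (all generators are traceless). [cite: TothGuhne2005, p. 3] -/
theorem trace_tgWitness' : (tgWitness' n).trace = n * 2 ^ (n + 1) := by
  rw [tgWitness', Matrix.trace_sub, Matrix.trace_smul, Matrix.trace_add, Matrix.trace_sum,
    trace_stabX, trace_one_register]
  simp_rw [trace_stabZZ]
  simp [Complex.real_smul]

/-- **`Tr(𝒲′ ϱ(p)) = pN − 1`** on `N = n + 1` qubits. [cite: TothGuhne2005, p. 3 (“The witness 𝒲′
… tolerates noise for p_noise < 1/N”)] -/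
theorem trState_tgWitness'_noisyGHZ (p : ℝ) :
    trState (noisyGHZ (n + 1) p) (tgWitness' n) = p * (n + 1) - 1 := by
  have hG : (vecMulVec (ghzN (n + 1)) (star (ghzN (n + 1))) * tgWitness' n).trace.re = -1 := by
    rw [← trState_apply, trState_vecMulVec, vecState_tgWitness'_ghzN]
  rw [trState_apply, noisyGHZ, Matrix.add_mul, Matrix.smul_mul, Matrix.smul_mul, Matrix.one_mul,
    Matrix.trace_add, Matrix.trace_smul, Matrix.trace_smul, trace_tgWitness', smul_eq_mul,
    smul_eq_mul, Complex.add_re, Complex.re_ofReal_mul, Complex.re_ofReal_mul, hG]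
  have h2 : ((n : ℂ) * 2 ^ (n + 1)).re = n * 2 ^ (n + 1) := by
    have : ((n : ℂ) * 2 ^ (n + 1)) = ((n * 2 ^ (n + 1) : ℝ) : ℂ) := by push_cast; ring
    rw [this, Complex.ofReal_re]
  rw [h2]
  have hpos : (2 : ℝ) ^ (n + 1) ≠ 0 := pow_ne_zero _ two_ne_zero
  field_simp
  ring

/-- **Noise tolerance of `𝒲′`**: detected iff `p < 1/N`. [cite: TothGuhne2005, p. 3] -/
theorem tgWitness'_detects_noisyGHZ (p : ℝ) :
    trState (noisyGHZ (n + 1) p) (tgWitness' n) < 0 ↔ p < 1 / (n + 1) := by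
  rw [trState_tgWitness'_noisyGHZ, lt_div_iff₀ (by positivity)]
  constructor <;> intro h <;> linarith

end SecondWitness

/-! ## Witnesses for full separability (Gühne–Tóth 2009 §6.6.5, eqs. (150)–(152)) -/

section FullSeparability

open SpinSqueezing

variable {n : ℕ}

/-- `σ_𝟙 = 𝟙` as a matrix. [cite: GuhneToth2009, §6.6.5] -/
private theorem pauliI_mat : (Pauli.I).mat = (1 : Matrix Bool Bool ℂ) := by
  ext a b; rw [Pauli.mat_I_apply, Matrix.one_apply]

/-- The pair of sites `{k−1, k}` = `{i.castSucc, i.succ}` as the filter of `univ`.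
[cite: GuhneToth2009, §6.6.5 eq. (151)] -/
private theorem filter_pair (i : Fin n) :
    Finset.univ.filter (fun j : Fin (n + 1) => j = i.castSucc ∨ j = i.succ) = {i.castSucc, i.succ} := by
  ext j; simp

/-- `i.castSucc ≠ i.succ`. [cite: GuhneToth2009, §6.6.5] -/
private theorem castSucc_ne_succ (i : Fin n) : i.castSucc ≠ i.succ := Fin.castSucc_lt_succ.ne

/-- **`⟨g₁⟩ = ⟨X₁⟩⟨X₂⟩⋯⟨X_N⟩` on a product state.** [cite: GuhneToth2009, §6.6.5 eq. (151)] -/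
theorem vecState_stabX_productVec (φ : Fin (n + 1) → Bool → ℂ) :
    vecState (productVec φ) (stabX (n + 1)) = ∏ k, bloch Pauli.X (φ k) := by
  rw [vecState_apply, stabX, pauliWord_mulVec_productVec, star_productVec_dotProduct]
  simp_rw [star_dotProduct_pauli_mulVec]
  rw [← Complex.ofReal_prod, Complex.ofReal_re]

/-- **`⟨g_m⟩ = ⟨Z_{m−1}⟩⟨Z_m⟩` on a product state** (unit factors). [cite: GuhneToth2009, §6.6.5
eq. (151)] -/
theorem vecState_stabZZ_productVec (i : Fin n) (φ : Fin (n + 1) → Bool → ℂ)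
    (hφ : ∀ k, star (φ k) ⬝ᵥ φ k = 1) :
    vecState (productVec φ) (stabZZ i) = bloch Pauli.Z (φ i.castSucc) * bloch Pauli.Z (φ i.succ) := by
  rw [vecState_apply, stabZZ, pauliWord_mulVec_productVec, star_productVec_dotProduct]
  have h : ∀ k, star (φ k) ⬝ᵥ ((if k = i.castSucc ∨ k = i.succ then Pauli.Z else Pauli.I).mat *ᵥ φ k) =
      if k = i.castSucc ∨ k = i.succ then (bloch Pauli.Z (φ k) : ℂ) else 1 := by
    intro k
    split_ifs with hk
    · exact star_dotProduct_pauli_mulVec _ _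
    · rw [pauliI_mat, one_mulVec, hφ k]
  simp_rw [h]
  rw [← Finset.prod_filter, filter_pair, Finset.prod_pair (castSucc_ne_succ i), ← Complex.ofReal_mul,
    Complex.ofReal_re]

/-- `⟨σ_x φ, σ_z φ⟩ = −i⟨φ|σ_y|φ⟩` (`σ_xσ_z = −iσ_y`). [cite: GuhneToth2009, §6.6.5 eq. (152)
(the term `g₁g_m`)] -/
theorem star_X_mulVec_dotProduct_Z_mulVec (φ : Bool → ℂ) :
    star (Pauli.X.mat *ᵥ φ) ⬝ᵥ (Pauli.Z.mat *ᵥ φ) = -I * (bloch Pauli.Y φ : ℂ) := by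
  rw [← star_dotProduct_pauli_mulVec]
  simp only [dotProduct, mulVec, Fintype.sum_bool, Pi.star_apply, Pauli.mat_X_apply, Pauli.mat_Y_apply,
    Pauli.mat_Z_apply, star_add, star_mul]
  simp
  linear_combination (-((starRingEnd ℂ) (φ false) * φ true - (starRingEnd ℂ) (φ true) * φ false)) * I_mul_I

/-- **`⟨g₁g_m⟩ = −⟨Y_{m−1}⟩⟨Y_m⟩ Π_{k ∉ {m−1,m}} ⟨X_k⟩` on a product state.**
[cite: GuhneToth2009, §6.6.5 eq. (152)] -/
theorem vecState_stabX_mul_stabZZ_productVec (i : Fin n) (φ : Fin (n + 1) → Bool → ℂ) :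
    vecState (productVec φ) (stabX (n + 1) * stabZZ i) =
      -(bloch Pauli.Y (φ i.castSucc) * bloch Pauli.Y (φ i.succ)) *
        ∏ k ∈ Finset.univ.filter (fun j : Fin (n + 1) => ¬ (j = i.castSucc ∨ j = i.succ)), bloch Pauli.X (φ k) := by
  have hH : (stabX (n + 1))ᴴ = stabX (n + 1) := (pauliWord_isHermitian _).eq
  rw [vecState_apply, ← mulVec_mulVec, ← hH, star_dotProduct_conjTranspose_mulVec, stabX, stabZZ,
    pauliWord_mulVec_productVec, pauliWord_mulVec_productVec, star_productVec_dotProduct]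
  have h : ∀ k, star (Pauli.X.mat *ᵥ φ k) ⬝ᵥ
      ((if k = i.castSucc ∨ k = i.succ then Pauli.Z else Pauli.I).mat *ᵥ φ k) =
      if k = i.castSucc ∨ k = i.succ then -I * (bloch Pauli.Y (φ k) : ℂ) else (bloch Pauli.X (φ k) : ℂ) := by
    intro k
    split_ifs with hk
    · exact star_X_mulVec_dotProduct_Z_mulVec _
    · rw [pauliI_mat, one_mulVec, star_pauli_mulVec_dotProduct]
  simp_rw [h]
  rw [Finset.prod_ite, filter_pair, Finset.prod_pair (castSucc_ne_succ i), ← Complex.ofReal_prod]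
  have : (-I * (bloch Pauli.Y (φ i.castSucc) : ℂ)) * (-I * (bloch Pauli.Y (φ i.succ) : ℂ)) =
      ((-(bloch Pauli.Y (φ i.castSucc) * bloch Pauli.Y (φ i.succ)) : ℝ) : ℂ) := by
    have hI : I * I = -1 := I_mul_I
    push_cast
    linear_combination (bloch Pauli.Y (φ i.castSucc) : ℂ) * (bloch Pauli.Y (φ i.succ) : ℂ) * hI
  rw [this, ← Complex.ofReal_mul, Complex.ofReal_re]

/-- Splitting `Π_k ⟨X_k⟩ = ⟨X_{m−1}⟩⟨X_m⟩ · Π_{k ∉ {m−1,m}} ⟨X_k⟩`. [cite: GuhneToth2009, §6.6.5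
eq. (151)] -/
private theorem prod_bloch_split (i : Fin n) (x : Fin (n + 1) → ℝ) :
    ∏ k, x k = x i.castSucc * x i.succ *
      ∏ k ∈ Finset.univ.filter (fun j : Fin (n + 1) => ¬ (j = i.castSucc ∨ j = i.succ)), x k := by
  rw [← Finset.prod_filter_mul_prod_filter_not Finset.univ (fun j : Fin (n + 1) => j = i.castSucc ∨ j = i.succ),
    filter_pair, Finset.prod_pair (castSucc_ne_succ i)]

/-- The remaining Bloch product is bounded: `|Π_{k ∉ {m−1,m}} ⟨X_k⟩| ≤ 1` for unit factors.
[cite: GuhneToth2009, §6.6.5 eq. (151) (“`|⟨X_k⟩| ≤ 1`”)] -/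
private theorem abs_prod_blochX_le (φ : Fin (n + 1) → Bool → ℂ) (hφ : ∀ k, star (φ k) ⬝ᵥ φ k = 1)
    (s : Finset (Fin (n + 1))) : |∏ k ∈ s, bloch Pauli.X (φ k)| ≤ 1 := by
  rw [Finset.abs_prod]
  refine Finset.prod_le_one (fun k _ => abs_nonneg _) fun k _ => ?_
  have h := bloch_sq_sum (φ k) (hφ k)
  exact abs_le_one_iff_mul_self_le_one.mpr
    (by nlinarith [sq_nonneg (bloch Pauli.Y (φ k)), sq_nonneg (bloch Pauli.Z (φ k))])

/-- **Eq. (151), the pure-product bound**: `⟨g₁⟩ + ⟨g_m⟩ = ⟨X₁⟩⋯⟨X_N⟩ + ⟨Z_{m−1}⟩⟨Z_m⟩ ≤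
|⟨X_{m−1}⟩||⟨X_m⟩| + |⟨Z_{m−1}⟩||⟨Z_m⟩| ≤ 1` on every product state (using `⟨X_i⟩² + ⟨Z_i⟩² ≤ 1`).
[cite: GuhneToth2009, §6.6.5 eq. (151)] -/
theorem stabX_add_stabZZ_productVec_le (i : Fin n) (φ : Fin (n + 1) → Bool → ℂ)
    (hφ : ∀ k, star (φ k) ⬝ᵥ φ k = 1) :
    vecState (productVec φ) (stabX (n + 1)) + vecState (productVec φ) (stabZZ i) ≤ 1 := by
  rw [vecState_stabX_productVec, vecState_stabZZ_productVec i φ hφ,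
    prod_bloch_split i (fun k => bloch Pauli.X (φ k))]
  set t := ∏ k ∈ Finset.univ.filter (fun j : Fin (n + 1) => ¬ (j = i.castSucc ∨ j = i.succ)),
    bloch Pauli.X (φ k)
  have ht : |t| ≤ 1 := abs_prod_blochX_le φ hφ _
  set xa := bloch Pauli.X (φ i.castSucc)
  set xb := bloch Pauli.X (φ i.succ)
  set za := bloch Pauli.Z (φ i.castSucc)
  set zb := bloch Pauli.Z (φ i.succ)
  have ha := bloch_sq_sum (φ i.castSucc) (hφ _)
  have hb := bloch_sq_sum (φ i.succ) (hφ _)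
  have h1 : xa * xb * t ≤ |xa| * |xb| := by
    have : xa * xb * t ≤ |xa * xb * t| := le_abs_self _
    rw [abs_mul, abs_mul] at this
    have h2 : |xa| * |xb| * |t| ≤ |xa| * |xb| * 1 := by gcongr
    linarith
  nlinarith [sq_nonneg (|xa| - |xb|), sq_nonneg (za - zb), sq_abs xa, sq_abs xb,
    sq_nonneg (bloch Pauli.Y (φ i.castSucc)), sq_nonneg (bloch Pauli.Y (φ i.succ))]

/-- **Eq. (152), the pure-product bound**: `⟨g₁⟩ + ⟨g_m⟩ + ⟨g₁g_m⟩ ≤ 1` on every product state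
(“The proof is similar”: with `c = ⟨X⟩⟨X′⟩ − ⟨Y⟩⟨Y′⟩`, `c² ≤ (1 − ⟨Z⟩²)(1 − ⟨Z′⟩²) ≤ (1 − ⟨Z⟩⟨Z′⟩)²`).
[cite: GuhneToth2009, §6.6.5 eq. (152)] -/
theorem stabX_add_stabZZ_add_prod_productVec_le (i : Fin n) (φ : Fin (n + 1) → Bool → ℂ)
    (hφ : ∀ k, star (φ k) ⬝ᵥ φ k = 1) :
    vecState (productVec φ) (stabX (n + 1)) + vecState (productVec φ) (stabZZ i) +
      vecState (productVec φ) (stabX (n + 1) * stabZZ i) ≤ 1 := by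
  rw [vecState_stabX_productVec, vecState_stabZZ_productVec i φ hφ,
    vecState_stabX_mul_stabZZ_productVec i φ, prod_bloch_split i (fun k => bloch Pauli.X (φ k))]
  set t := ∏ k ∈ Finset.univ.filter (fun j : Fin (n + 1) => ¬ (j = i.castSucc ∨ j = i.succ)),
    bloch Pauli.X (φ k)
  have ht : |t| ≤ 1 := abs_prod_blochX_le φ hφ _
  set xa := bloch Pauli.X (φ i.castSucc)
  set xb := bloch Pauli.X (φ i.succ)
  set ya := bloch Pauli.Y (φ i.castSucc)
  set yb := bloch Pauli.Y (φ i.succ)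
  set za := bloch Pauli.Z (φ i.castSucc)
  set zb := bloch Pauli.Z (φ i.succ)
  have ha := bloch_sq_sum (φ i.castSucc) (hφ _)
  have hb := bloch_sq_sum (φ i.succ) (hφ _)
  -- the combination is `t·c + za·zb` with `c = xa xb − ya yb`
  have hB : (xa * xb - ya * yb) ^ 2 + (xa * yb + ya * xb) ^ 2 = (1 - za ^ 2) * (1 - zb ^ 2) := by
    have ha' : xa ^ 2 + ya ^ 2 = 1 - za ^ 2 := by linarith
    have hb' : xb ^ 2 + yb ^ 2 = 1 - zb ^ 2 := by linarith
    rw [← ha', ← hb']; ring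
  have hc2 : (xa * xb - ya * yb) ^ 2 ≤ (1 - za * zb) ^ 2 := by
    nlinarith [hB, sq_nonneg (za - zb), sq_nonneg (xa * yb + ya * xb)]
  have hz1 : 0 ≤ 1 - za * zb := by
    nlinarith [sq_nonneg (za - zb), sq_nonneg xa, sq_nonneg ya, sq_nonneg xb, sq_nonneg yb]
  have hc : |xa * xb - ya * yb| ≤ 1 - za * zb := abs_le_of_sq_le_sq' hc2 hz1 |>.2 |> fun h => by
    exact abs_le.mpr ⟨(abs_le_of_sq_le_sq' hc2 hz1).1, h⟩
  have htc : t * (xa * xb - ya * yb) ≤ |xa * xb - ya * yb| := by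
    have h0 : t * (xa * xb - ya * yb) ≤ |t * (xa * xb - ya * yb)| := le_abs_self _
    rw [abs_mul] at h0
    have h2 : |t| * |xa * xb - ya * yb| ≤ 1 * |xa * xb - ya * yb| := by gcongr
    linarith
  have e : xa * xb * t + za * zb + -(ya * yb) * t = t * (xa * xb - ya * yb) + za * zb := by ring
  rw [e]
  linarith

/-- **The witness (150)**: `𝒲_m^{(GHZ_N)} = 𝟙 − g₁^{(GHZ_N)} − g_m^{(GHZ_N)}`, `m = 2, …, N`
(`g₁ = S₁ = σ_x^{⊗N}`, `g_m = S_m = σ_z^{(m−1)}σ_z^{(m)}`). [cite: GuhneToth2009, §6.6.5 eq. (150)] -/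
noncomputable def fullSepWitness (i : Fin n) : Matrix (Fin (n + 1) → Bool) (Fin (n + 1) → Bool) ℂ :=
  1 - stabX (n + 1) - stabZZ i

/-- **The witness (152)**: `𝒲̂_m^{(GHZ_N)} = 𝟙 − g₁ − g_m − g₁g_m`. [cite: GuhneToth2009, §6.6.5
eq. (152)] -/
noncomputable def fullSepWitness' (i : Fin n) : Matrix (Fin (n + 1) → Bool) (Fin (n + 1) → Bool) ℂ :=
  1 - stabX (n + 1) - stabZZ i - stabX (n + 1) * stabZZ i

/-- `⟨ψ|ψ⟩ = 1` for a unit product vector. [cite: GuhneToth2009, §6.6.5] -/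
private theorem norm_productVec (φ : Fin (n + 1) → Bool → ℂ) (hφ : ∀ k, star (φ k) ⬝ᵥ φ k = 1) :
    star (productVec φ) ⬝ᵥ productVec φ = 1 := by
  rw [star_productVec_dotProduct]; exact Finset.prod_eq_one fun k _ => hφ k

/-- **(150) on fully separable states: `Tr(𝒲_m ϱ) ≥ 0`, i.e. `⟨g₁⟩_ϱ + ⟨g_m⟩_ϱ ≤ 1`** (“By
convexity, the bound is also valid for mixed separable states”). [cite: GuhneToth2009, §6.6.5
eqs. (150)–(151)] -/
theorem stabX_add_stabZZ_le_one {ρ : Matrix (Fin (n + 1) → Bool) (Fin (n + 1) → Bool) ℂ}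
    (hρ : IsSeparable ρ) (i : Fin n) : trState ρ (stabX (n + 1)) + trState ρ (stabZZ i) ≤ 1 := by
  obtain ⟨ι, _, p, ψ, hp, h1, hψ, rfl⟩ := hρ
  rw [trState_mixture, trState_mixture, ← Finset.sum_add_distrib, ← h1]
  refine Finset.sum_le_sum fun k _ => ?_
  obtain ⟨φ, hφ, hk⟩ := hψ k
  have h := stabX_add_stabZZ_productVec_le i φ hφ
  rw [← hk] at h
  nlinarith [hp k]

/-- **`Tr(𝒲_m ϱ) ≥ 0` for fully separable `ϱ`.** [cite: GuhneToth2009, §6.6.5 eq. (150)] -/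
theorem trState_fullSepWitness_nonneg {ρ : Matrix (Fin (n + 1) → Bool) (Fin (n + 1) → Bool) ℂ}
    (hρ : IsSeparable ρ) (i : Fin n) : 0 ≤ trState ρ (fullSepWitness i) := by
  have htr : trState ρ 1 = 1 := by
    obtain ⟨ι, _, p, ψ, hp, h1, hψ, rfl⟩ := hρ
    rw [trState_mixture, ← h1]
    refine Finset.sum_congr rfl fun k _ => ?_
    obtain ⟨φ, hφ, hk⟩ := hψ k
    rw [vecState_one, hk, norm_productVec φ hφ, Complex.one_re, mul_one]
  have h := stabX_add_stabZZ_le_one hρ i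
  rw [fullSepWitness, map_sub, map_sub, htr]
  linarith

/-- **Entanglement criterion from (150)**: `⟨σ_x^{⊗N}⟩_ϱ + ⟨σ_z^{(m−1)}σ_z^{(m)}⟩_ϱ > 1 ⟹ ϱ` is
entangled (not fully separable). [cite: GuhneToth2009, §6.6.5 eqs. (150)–(151)] -/
theorem not_isSeparable_of_one_lt {ρ : Matrix (Fin (n + 1) → Bool) (Fin (n + 1) → Bool) ℂ} (i : Fin n)
    (h : 1 < trState ρ (stabX (n + 1)) + trState ρ (stabZZ i)) : ¬ IsSeparable ρ :=
  fun hρ => absurd h (not_lt.2 (stabX_add_stabZZ_le_one hρ i))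

/-- **(152) on fully separable states: `⟨g₁⟩_ϱ + ⟨g_m⟩_ϱ + ⟨g₁g_m⟩_ϱ ≤ 1`.**
[cite: GuhneToth2009, §6.6.5 eq. (152)] -/
theorem stabX_add_stabZZ_add_prod_le_one {ρ : Matrix (Fin (n + 1) → Bool) (Fin (n + 1) → Bool) ℂ}
    (hρ : IsSeparable ρ) (i : Fin n) :
    trState ρ (stabX (n + 1)) + trState ρ (stabZZ i) + trState ρ (stabX (n + 1) * stabZZ i) ≤ 1 := by
  obtain ⟨ι, _, p, ψ, hp, h1, hψ, rfl⟩ := hρ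
  rw [trState_mixture, trState_mixture, trState_mixture, ← Finset.sum_add_distrib, ← Finset.sum_add_distrib,
    ← h1]
  refine Finset.sum_le_sum fun k _ => ?_
  obtain ⟨φ, hφ, hk⟩ := hψ k
  have h := stabX_add_stabZZ_add_prod_productVec_le i φ hφ
  rw [← hk] at h
  nlinarith [hp k]

/-- **`Tr(𝒲̂_m ϱ) ≥ 0` for fully separable `ϱ`.** [cite: GuhneToth2009, §6.6.5 eq. (152)] -/
theorem trState_fullSepWitness'_nonneg {ρ : Matrix (Fin (n + 1) → Bool) (Fin (n + 1) → Bool) ℂ}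
    (hρ : IsSeparable ρ) (i : Fin n) : 0 ≤ trState ρ (fullSepWitness' i) := by
  have htr : trState ρ 1 = 1 := by
    obtain ⟨ι, _, p, ψ, hp, h1, hψ, rfl⟩ := hρ
    rw [trState_mixture, ← h1]
    refine Finset.sum_congr rfl fun k _ => ?_
    obtain ⟨φ, hφ, hk⟩ := hψ k
    rw [vecState_one, hk, norm_productVec φ hφ, Complex.one_re, mul_one]
  have h := stabX_add_stabZZ_add_prod_le_one hρ i
  rw [fullSepWitness', map_sub, map_sub, map_sub, htr]
  linarith

/-! ### The GHZ values and the noise tolerances `p_noise < 1/2` and `< 2/3` -/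

/-- `S_m|GHZ_N⟩ = |GHZ_N⟩`. [cite: GuhneToth2009, §6.6.5 (GHZ stabilizers); TothGuhne2005, p. 2] -/
theorem stabZZ_mulVec_ghzN (i : Fin n) : stabZZ i *ᵥ ghzN (n + 1) = ghzN (n + 1) := by
  rw [stabZZ_eq_diagonal]
  funext x
  rw [mulVec_diagonal]
  by_cases hx : x = constLabel (n + 1) false ∨ x = constLabel (n + 1) true
  · rcases hx with h | h <;> simp [h]
  · have h0 : ghzN (n + 1) x = 0 := by
      push Not at hx
      rw [ghzN]
      simp [Pi.add_apply, Pi.smul_apply, ket_of_ne hx.1, ket_of_ne hx.2]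
    rw [h0, mul_zero]

/-- `⟨GHZ_N| g₁g_m |GHZ_N⟩ = 1`. [cite: GuhneToth2009, §6.6.5 eq. (152)] -/
theorem vecState_stabX_mul_stabZZ_ghzN (i : Fin n) :
    vecState (ghzN (n + 1)) (stabX (n + 1) * stabZZ i) = 1 := by
  rw [vecState_apply, ← mulVec_mulVec, stabZZ_mulVec_ghzN, stabX_mulVec_ghzN, ghzN_norm, Complex.one_re]

/-- `⟨GHZ_N|S₁|GHZ_N⟩ = 1`. [cite: TothGuhne2005, p. 2 (“stabilizing operators”)] -/
theorem vecState_stabX_ghzN' : vecState (ghzN (n + 1)) (stabX (n + 1)) = 1 := by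
  rw [vecState_apply, stabX_mulVec_ghzN, ghzN_norm, Complex.one_re]

/-- `Tr(g₁ g_m) = 0`: `g_m` is diagonal and `g₁` has zero diagonal. [cite: GuhneToth2009, §6.6.5
(white-noise tolerance of (152))] -/
theorem trace_stabX_mul_stabZZ (i : Fin n) : (stabX (n + 1) * stabZZ i).trace = 0 := by
  rw [stabZZ_eq_diagonal, Matrix.trace]
  refine Finset.sum_eq_zero fun x _ => ?_
  rw [Matrix.diag_apply, mul_diagonal, stabX_apply, if_neg, zero_mul]
  intro h
  have := congrFun h 0
  simp [flipAll] at this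

/-- **`Tr(𝒲_m ϱ(p)) = 2p − 1`** on the noisy GHZ state `ϱ(p) = p𝟙/2^N + (1−p)|GHZ_N⟩⟨GHZ_N|`.
[cite: GuhneToth2009, §6.6.5 (“These witnesses tolerate noise if p_noise < 1/2 and 2/3,
respectively”)] -/
theorem trState_fullSepWitness_noisyGHZ (i : Fin n) (p : ℝ) :
    trState (noisyGHZ (n + 1) p) (fullSepWitness i) = 2 * p - 1 := by
  have hG : (vecMulVec (ghzN (n + 1)) (star (ghzN (n + 1))) * fullSepWitness i).trace.re = -1 := by
    rw [← trState_apply, trState_vecMulVec, fullSepWitness, map_sub, map_sub, vecState_one, ghzN_norm,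
      Complex.one_re, vecState_stabX_ghzN', vecState_stabZZ_ghzN]
    ring
  have hW : (fullSepWitness i).trace = 2 ^ (n + 1) := by
    rw [fullSepWitness, trace_sub, trace_sub, trace_one_register, trace_stabX, trace_stabZZ]; ring
  rw [trState_apply, noisyGHZ, Matrix.add_mul, Matrix.smul_mul, Matrix.smul_mul, Matrix.one_mul,
    Matrix.trace_add, Matrix.trace_smul, Matrix.trace_smul, hW, smul_eq_mul, smul_eq_mul, Complex.add_re,
    Complex.re_ofReal_mul, Complex.re_ofReal_mul, hG]
  have h2 : ((2 : ℂ) ^ (n + 1)).re = 2 ^ (n + 1) := by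
    rw [show ((2 : ℂ) ^ (n + 1)) = ((2 ^ (n + 1) : ℝ) : ℂ) by push_cast; ring, Complex.ofReal_re]
  rw [h2]
  have hpos : (2 : ℝ) ^ (n + 1) ≠ 0 := pow_ne_zero _ two_ne_zero
  field_simp
  ring

/-- **Noise tolerance of (150): detected iff `p_noise < 1/2`.** [cite: GuhneToth2009, §6.6.5] -/
theorem fullSepWitness_detects_noisyGHZ (i : Fin n) (p : ℝ) :
    trState (noisyGHZ (n + 1) p) (fullSepWitness i) < 0 ↔ p < 1 / 2 := by
  rw [trState_fullSepWitness_noisyGHZ]; constructor <;> intro h <;> linarith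

/-- **`Tr(𝒲̂_m ϱ(p)) = 3p − 2`** on the noisy GHZ state. [cite: GuhneToth2009, §6.6.5] -/
theorem trState_fullSepWitness'_noisyGHZ (i : Fin n) (p : ℝ) :
    trState (noisyGHZ (n + 1) p) (fullSepWitness' i) = 3 * p - 2 := by
  have hG : (vecMulVec (ghzN (n + 1)) (star (ghzN (n + 1))) * fullSepWitness' i).trace.re = -2 := by
    rw [← trState_apply, trState_vecMulVec, fullSepWitness', map_sub, map_sub, map_sub, vecState_one,
      ghzN_norm, Complex.one_re, vecState_stabX_ghzN', vecState_stabZZ_ghzN, vecState_stabX_mul_stabZZ_ghzN]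
    ring
  have hW : (fullSepWitness' i).trace = 2 ^ (n + 1) := by
    rw [fullSepWitness', trace_sub, trace_sub, trace_sub, trace_one_register, trace_stabX, trace_stabZZ,
      trace_stabX_mul_stabZZ]; ring
  rw [trState_apply, noisyGHZ, Matrix.add_mul, Matrix.smul_mul, Matrix.smul_mul, Matrix.one_mul,
    Matrix.trace_add, Matrix.trace_smul, Matrix.trace_smul, hW, smul_eq_mul, smul_eq_mul, Complex.add_re,
    Complex.re_ofReal_mul, Complex.re_ofReal_mul, hG]
  have h2 : ((2 : ℂ) ^ (n + 1)).re = 2 ^ (n + 1) := by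
    rw [show ((2 : ℂ) ^ (n + 1)) = ((2 ^ (n + 1) : ℝ) : ℂ) by push_cast; ring, Complex.ofReal_re]
  rw [h2]
  have hpos : (2 : ℝ) ^ (n + 1) ≠ 0 := pow_ne_zero _ two_ne_zero
  field_simp
  ring

/-- **Noise tolerance of (152): detected iff `p_noise < 2/3`** (“more terms make it possible to
have higher noise tolerance”). [cite: GuhneToth2009, §6.6.5] -/
theorem fullSepWitness'_detects_noisyGHZ (i : Fin n) (p : ℝ) :
    trState (noisyGHZ (n + 1) p) (fullSepWitness' i) < 0 ↔ p < 2 / 3 := by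
  rw [trState_fullSepWitness'_noisyGHZ]; constructor <;> intro h <;> linarith

/-- The noisy GHZ state is entangled (not fully separable) for every `p < 2/3` (`N ≥ 2`).
[cite: GuhneToth2009, §6.6.5 eq. (152)] -/
theorem not_isSeparable_noisyGHZ (i : Fin n) {p : ℝ} (hp : p < 2 / 3) :
    ¬ IsSeparable (noisyGHZ (n + 1) p) := fun hρ =>
  absurd (trState_fullSepWitness'_nonneg hρ i)
    (not_le.mpr ((fullSepWitness'_detects_noisyGHZ i p).mpr hp))

end FullSeparability

/-! ## The Bell operator of Mermin's inequality is a stabilizer operator (Tóth–Gühne 2005, Theorem 4) -/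

section MerminOperator

/-- The number of `σ_y` letters of a setting word `s` (`false ↦ σ_x`, `true ↦ σ_y`).
[cite: TothGuhne2005Stabilizer, Theorem 4 (the terms `Y Y X ⋯ X`, `Y Y Y Y X ⋯ X`, …)] -/
def yCount (s : Fin N → Bool) : ℕ := (Finset.univ.filter fun j => s j = true).card

/-- The Mermin coefficient of the word `s`: `Re(i^{#y}) = (i^{#y} + (−i)^{#y})/2`, i.e. `+1, 0, −1, 0`
for `#y ≡ 0, 1, 2, 3 (mod 4)` — the signs of `X⋯X − Σ YYX⋯X + Σ YYYYX⋯X − …`.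
[cite: TothGuhne2005Stabilizer, Theorem 4] -/
noncomputable def merminCoeff (s : Fin N → Bool) : ℂ := (I ^ yCount s + (-I) ^ yCount s) / 2

/-- `merminCoeff s = (−1)^{#y/2}` for even `#y` and `0` for odd `#y`.
[cite: TothGuhne2005Stabilizer, Theorem 4] -/
theorem merminCoeff_eq_ite (s : Fin N → Bool) :
    merminCoeff s = if Even (yCount s) then (-1 : ℂ) ^ (yCount s / 2) else 0 := by
  rw [merminCoeff]
  rcases Nat.even_or_odd (yCount s) with ⟨m, hm⟩ | ⟨m, hm⟩
  · rw [if_pos ⟨m, hm⟩, hm, ← two_mul, pow_mul, pow_mul, neg_sq, I_sq,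
      Nat.mul_div_cancel_left m two_pos]
    ring
  · rw [if_neg (Nat.not_even_iff_odd.mpr ⟨m, hm⟩), hm, pow_succ, pow_succ, pow_mul, pow_mul, neg_sq,
      I_sq]
    ring

/-- **The Bell operator of Mermin's inequality**,
`M_N := 2^{−(N−1)} [X X X X ⋯ X X − Y Y X X ⋯ X X + Y Y Y Y ⋯ X X − …]` (each term standing for
the sum of all its permutations), as the `σ_x/σ_y`-word sum `2^{−(N−1)} Σ_s Re(i^{#y(s)}) O_s`.
[cite: TothGuhne2005Stabilizer, Theorem 4] -/
noncomputable def merminOp (N : ℕ) : Matrix (Fin N → Bool) (Fin N → Bool) ℂ :=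
  ((2 : ℂ) ^ (N - 1))⁻¹ • ∑ s : Fin N → Bool, merminCoeff s • obsWord s

/-- Off the anti-diagonal every `σ_x/σ_y` word vanishes: `⟨x|O_s|y⟩ = 0` unless `y = x̄`.
[cite: TothGuhne2005Stabilizer, Theorem 4 (proof: `M_N = |0…0⟩⟨1…1| + |1…1⟩⟨0…0|`)] -/
theorem obsWord_apply_of_ne_flipAll (s : Fin N → Bool) {x y : Fin N → Bool} (h : y ≠ flipAll x) :
    obsWord s x y = 0 := by
  rw [obsWord_apply]
  have hex : ∃ j, y j = x j := by
    by_contra hall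
    push Not at hall
    apply h
    funext j
    have hj := hall j
    rw [flipAll]
    cases hy : y j <;> cases hx : x j <;> simp_all
  obtain ⟨j, hj⟩ := hex
  refine Finset.prod_eq_zero (Finset.mem_univ j) ?_
  rw [hj]
  cases s j <;> simp [settingPauli]

/-- On the anti-diagonal: `⟨x|O_s|x̄⟩ = Π_{j : s_j = y} (x_j ? i : −i)` (`σ_x(a, ā) = 1`,
`σ_y(0,1) = −i`, `σ_y(1,0) = i`). [cite: TothGuhne2005Stabilizer, Theorem 4 (proof)] -/
theorem obsWord_apply_flipAll (s x : Fin N → Bool) :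
    obsWord s x (flipAll x) = ∏ j, (if s j then (if x j then I else -I) else 1) := by
  rw [obsWord_apply]
  refine Finset.prod_congr rfl fun j _ => ?_
  rw [flipAll]
  cases s j <;> cases x j <;> simp [settingPauli]

/-- The generating function behind the Mermin signs: for any `c` and factors `u_j`,
`Σ_s c^{#y(s)} Π_{j : s_j} u_j = Π_j (1 + c u_j)`. [cite: TothGuhne2005Stabilizer, Theorem 4 (proof)] -/
private theorem sum_pow_yCount_mul_prod (c : ℂ) (u : Fin N → ℂ) :
    ∑ s : Fin N → Bool, c ^ yCount s * ∏ j, (if s j then u j else 1) = ∏ j, (1 + c * u j) := by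
  have h1 : ∀ s : Fin N → Bool, c ^ yCount s * ∏ j, (if s j then u j else 1) =
      ∏ j, (if s j then c * u j else 1) := by
    intro s
    rw [yCount, Finset.prod_ite, Finset.prod_const_one, mul_one, Finset.prod_ite,
      Finset.prod_const_one, mul_one, Finset.prod_mul_distrib, Finset.prod_const]
  simp_rw [h1]
  have h2 : ∏ j, (1 + c * u j) = ∏ j, ∑ b : Bool, (if b then c * u j else 1) := by
    refine Finset.prod_congr rfl fun j _ => ?_
    rw [Fintype.sum_bool, if_pos rfl]; simp; ring
  rw [h2, Finset.prod_univ_sum (fun _ => (Finset.univ : Finset Bool)) (fun j b => if b then c * u j else 1),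
    Fintype.piFinset_univ]

/-- `Π_j (x_j ? 0 : 2) = 2^N [x = 0…0]` and `Π_j (x_j ? 2 : 0) = 2^N [x = 1…1]`.
[cite: TothGuhne2005Stabilizer, Theorem 4 (proof)] -/
private theorem prod_ite_two_zero (x : Fin N → Bool) (b : Bool) :
    ∏ j, (if x j = b then (2 : ℂ) else 0) = if x = constLabel N b then 2 ^ N else 0 := by
  by_cases h : x = constLabel N b
  · subst h
    rw [if_pos rfl]
    simp [constLabel_apply]
  · rw [if_neg h]
    have hex : ∃ j, x j ≠ b := by
      by_contra hall; push Not at hall; exact h (funext fun j => by rw [constLabel_apply]; exact hall j)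
    obtain ⟨j, hj⟩ := hex
    exact Finset.prod_eq_zero (Finset.mem_univ j) (if_neg hj)

/-- **The anti-diagonal of the Mermin sum**: `Σ_s Re(i^{#y(s)}) ⟨x|O_s|x̄⟩ = 2^{N−1}([x = 0…0] + [x = 1…1])`.
[cite: TothGuhne2005Stabilizer, Theorem 4 (proof)] -/
theorem sum_merminCoeff_mul_obsWord_flipAll [NeZero N] (x : Fin N → Bool) :
    ∑ s : Fin N → Bool, merminCoeff s * obsWord s x (flipAll x) =
      2 ^ (N - 1) * ((if x = constLabel N false then (1 : ℂ) else 0) +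
        (if x = constLabel N true then (1 : ℂ) else 0)) := by
  simp_rw [obsWord_apply_flipAll, merminCoeff]
  have hsplit : ∑ s : Fin N → Bool, (I ^ yCount s + (-I) ^ yCount s) / 2 *
      ∏ j, (if s j then (if x j then I else -I) else 1) =
      (∑ s : Fin N → Bool, I ^ yCount s * ∏ j, (if s j then (if x j then I else -I) else 1) +
        ∑ s : Fin N → Bool, (-I) ^ yCount s * ∏ j, (if s j then (if x j then I else -I) else 1)) / 2 := by
    rw [← Finset.sum_add_distrib, Finset.sum_div]
    refine Finset.sum_congr rfl fun s _ => by ring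
  rw [hsplit, sum_pow_yCount_mul_prod, sum_pow_yCount_mul_prod]
  have hA : ∀ j, 1 + I * (if x j then I else -I) = if x j = false then (2 : ℂ) else 0 := by
    intro j; cases x j <;> norm_num
  have hB : ∀ j, 1 + -I * (if x j then I else -I) = if x j = true then (2 : ℂ) else 0 := by
    intro j; cases x j <;> norm_num
  simp_rw [hA, hB]
  rw [prod_ite_two_zero, prod_ite_two_zero]
  have hN : (2 : ℂ) ^ N = 2 * 2 ^ (N - 1) := by
    rw [← pow_succ', Nat.sub_add_cancel (Nat.one_le_iff_ne_zero.mpr (NeZero.ne N))]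
  rw [hN]
  split_ifs <;> ring

/-- `0…0 ≠ 1…1` flipped: `x̄` of a constant string is the other constant string.
[cite: TothGuhne2005Stabilizer, Theorem 4 (proof)] -/
theorem flipAll_constLabel (b : Bool) : flipAll (constLabel N b) = constLabel N (!b) := rfl

/-- **`M_N = |0…0⟩⟨1…1| + |1…1⟩⟨0…0|`** (`N ≥ 1`). [cite: TothGuhne2005Stabilizer, Theorem 4
(proof, eq. “`M_N = … = |00…0⟩⟨11…1| + |11…1⟩⟨00…0|`”)] -/
theorem merminOp_eq [NeZero N] : merminOp N =
    vecMulVec (ket (constLabel N false)) (ket (constLabel N true)) +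
      vecMulVec (ket (constLabel N true)) (ket (constLabel N false)) := by
  have hne := constLabel_false_ne_true (N := N)
  ext x y
  rw [merminOp, Matrix.smul_apply, Matrix.sum_apply, Matrix.add_apply, vecMulVec_apply,
    vecMulVec_apply, ket_apply, ket_apply, ket_apply, ket_apply, smul_eq_mul]
  simp_rw [Matrix.smul_apply, smul_eq_mul]
  by_cases hy : y = flipAll x
  · subst hy
    rw [sum_merminCoeff_mul_obsWord_flipAll, ← mul_assoc, inv_mul_cancel₀ (pow_ne_zero _ two_ne_zero),
      one_mul]
    by_cases h0 : x = constLabel N false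
    · subst h0
      rw [if_pos rfl, if_neg hne, flipAll_constLabel, Bool.not_false, if_pos rfl, if_neg hne.symm]; ring
    · rw [if_neg h0]
      by_cases h1 : x = constLabel N true
      · subst h1; rw [if_pos rfl, flipAll_constLabel, Bool.not_true, if_pos rfl, if_neg hne]; ring
      · rw [if_neg h1]
        have h2 : flipAll x ≠ constLabel N true := fun h => h0 (by
          rw [← flipAll_flipAll x, h, flipAll_constLabel]; rfl)
        rw [if_neg h2]; ring
  · rw [Finset.sum_eq_zero fun s _ => by rw [obsWord_apply_of_ne_flipAll s hy, mul_zero], mul_zero]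
    by_cases h0 : x = constLabel N false
    · subst h0
      have h1 : y ≠ constLabel N true := fun h => hy (by rw [h, flipAll_constLabel]; rfl)
      rw [if_pos rfl, if_neg h1, if_neg hne]; ring
    · rw [if_neg h0]
      by_cases h1 : x = constLabel N true
      · subst h1
        have h2 : y ≠ constLabel N false := fun h => hy (by rw [h, flipAll_constLabel]; rfl)
        rw [if_neg h2]; ring
      · rw [if_neg h1]; ring

/-- **`M_N = S₁ Π_{k=2}^N (S_k + 𝟙)/2`**: the Mermin operator “contains also only stabilizing
terms” (`S₁ = σ_x^{⊗N}` and the projector `projEq = Π_k (S_k + 𝟙)/2` of `projEq_eq_prod`).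
[cite: TothGuhne2005Stabilizer, Theorem 4 (proof, first line)] -/
theorem merminOp_eq_stabX_mul_projEq [NeZero N] : merminOp N = stabX N * projEq N := by
  have hne := constLabel_false_ne_true (N := N)
  rw [merminOp_eq]
  ext x y
  rw [projEq, mul_diagonal, stabX_apply, Matrix.add_apply, vecMulVec_apply, vecMulVec_apply,
    ket_apply, ket_apply, ket_apply, ket_apply]
  by_cases hy : y = flipAll x
  · subst hy
    rw [if_pos rfl, one_mul]
    by_cases hc : ∀ i j, flipAll x i = flipAll x j
    · rw [if_pos hc]
      rcases (const_iff_eq_constLabel _).1 hc with h | h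
      · have hx : x = constLabel N true := by rw [← flipAll_flipAll x, h, flipAll_constLabel]; rfl
        subst hx; rw [h, if_neg hne.symm, if_pos rfl, if_pos rfl]; ring
      · have hx : x = constLabel N false := by rw [← flipAll_flipAll x, h, flipAll_constLabel]; rfl
        subst hx; rw [h, if_pos rfl, if_pos rfl, if_neg hne]; ring
    · rw [if_neg hc]
      have h0 : x ≠ constLabel N false := fun h => hc ((const_iff_eq_constLabel _).2
        (Or.inr (by rw [h, flipAll_constLabel]; rfl)))
      have h1 : x ≠ constLabel N true := fun h => hc ((const_iff_eq_constLabel _).2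
        (Or.inl (by rw [h, flipAll_constLabel]; rfl)))
      rw [if_neg h0, if_neg h1]; ring
  · rw [if_neg hy, zero_mul]
    by_cases h0 : x = constLabel N false
    · subst h0
      have h1 : y ≠ constLabel N true := fun h => hy (by rw [h, flipAll_constLabel]; rfl)
      rw [if_pos rfl, if_neg h1, if_neg hne]; ring
    · rw [if_neg h0]
      by_cases h1 : x = constLabel N true
      · subst h1
        have h2 : y ≠ constLabel N false := fun h => hy (by rw [h, flipAll_constLabel]; rfl)
        rw [if_neg h2]; ring
      · rw [if_neg h1]; ring

/-- `(|u⟩⟨v|)ψ = ⟨v̄, ψ⟩ u` for real basis kets: `vecMulVec (ket a) (ket b) *ᵥ ψ = ψ(b) • ket a`.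
[cite: TothGuhne2005Stabilizer, Theorem 4 (proof)] -/
private theorem vecMulVec_ket_mulVec (a b : Fin N → Bool) (ψ : (Fin N → Bool) → ℂ) :
    vecMulVec (ket a) (ket b) *ᵥ ψ = ψ b • ket a := by
  ext x
  simp [mulVec, dotProduct, vecMulVec_apply, ket_apply, mul_comm]

/-- **`⟨ψ|M_N|ψ⟩ = 2 Re(ψ̄(0…0) ψ(1…1))`** (`N ≥ 1`). [cite: TothGuhne2005Stabilizer, Theorem 4 (proof)] -/
theorem vecState_merminOp [NeZero N] (ψ : (Fin N → Bool) → ℂ) :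
    vecState ψ (merminOp N) =
      2 * (star (ψ (constLabel N false)) * ψ (constLabel N true)).re := by
  rw [merminOp_eq, map_add, vecState_apply, vecState_apply, vecMulVec_ket_mulVec,
    vecMulVec_ket_mulVec, dotProduct_smul, dotProduct_smul, smul_eq_mul, smul_eq_mul]
  have h0 : star ψ ⬝ᵥ ket (constLabel N false) = star (ψ (constLabel N false)) := by
    rw [dotProduct_ket, Pi.star_apply]
  have h1 : star ψ ⬝ᵥ ket (constLabel N true) = star (ψ (constLabel N true)) := by
    rw [dotProduct_ket, Pi.star_apply]
  rw [h0, h1]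
  have h2 : (ψ (constLabel N false) * star (ψ (constLabel N true))) =
      star (star (ψ (constLabel N false)) * ψ (constLabel N true)) := by
    rw [star_mul', star_star, mul_comm]
  rw [h2, Complex.star_def, Complex.conj_re, mul_comm (ψ (constLabel N true))]
  ring

/-- `(M|a⟩)_b = M_{ba}`. [cite: TothGuhne2005Stabilizer, Theorem 4 (proof)] -/
private theorem mulVec_ket_apply (M : Matrix (Fin N → Bool) (Fin N → Bool) ℂ) (a b : Fin N → Bool) :
    (M *ᵥ ket a) b = M b a := by
  change (fun j => M b j) ⬝ᵥ ket a = M b a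
  exact dotProduct_ket _ _

/-- **`Re Tr(ϱ M_N) = Re(ϱ_{1…1,0…0} + ϱ_{0…0,1…1})`** — the GHZ coherences (`N ≥ 1`).
[cite: TothGuhne2005Stabilizer, Theorem 4] -/
theorem trState_merminOp [NeZero N] (ρ : Matrix (Fin N → Bool) (Fin N → Bool) ℂ) :
    trState ρ (merminOp N) =
      (ρ (constLabel N true) (constLabel N false) + ρ (constLabel N false) (constLabel N true)).re := by
  rw [merminOp_eq, map_add, trState_apply, trState_apply, Matrix.mul_vecMulVec, Matrix.mul_vecMulVec,
    Matrix.trace_vecMulVec, Matrix.trace_vecMulVec, dotProduct_ket, dotProduct_ket, mulVec_ket_apply,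
    mulVec_ket_apply, Complex.add_re]

/-- **`|GHZ_N⟩⟨GHZ_N| − M_N = |GHZ_N^−⟩⟨GHZ_N^−|`** with `|GHZ_N^−⟩ = (|0…0⟩ − |1…1⟩)/√2` = the
phase-family member `ghzPhase N (−1)` (`N ≥ 1`). [cite: TothGuhne2005Stabilizer, Theorem 4 (proof,
“`|GHZ_N^−⟩ = (|0000…⟩ − |1111…⟩)/√2`”)] -/
theorem ghzProj_sub_merminOp [NeZero N] :
    vecMulVec (ghzN N) (star (ghzN N)) - merminOp N = vecMulVec (ghzPhase N (-1)) (star (ghzPhase N (-1))) := by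
  have hc : (CHSHOpt.invSqrtTwo : ℂ) * (CHSHOpt.invSqrtTwo : ℂ) = 1 / 2 := by
    rw [← Complex.ofReal_mul, CHSHOpt.invSqrtTwo_mul_self]; push_cast; ring
  rw [merminOp_eq, ← ghzPhase_one]
  ext x y
  have e : ∀ (c : ℂ) (z : Fin N → Bool), ghzPhase N c z =
      (CHSHOpt.invSqrtTwo : ℂ) * (ket (constLabel N false) z + c * ket (constLabel N true) z) := by
    intro c z; simp [ghzPhase]
  have es : ∀ (c : ℂ) (z : Fin N → Bool), star (ghzPhase N c) z =
      (CHSHOpt.invSqrtTwo : ℂ) * (ket (constLabel N false) z + star c * ket (constLabel N true) z) := by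
    intro c z
    have h0 := congrFun (star_ket (constLabel N false)) z
    have h1 := congrFun (star_ket (constLabel N true)) z
    rw [Pi.star_apply] at h0 h1
    rw [Pi.star_apply, e, star_mul', star_add, star_mul', h0, h1, Complex.star_def,
      Complex.conj_ofReal]
  rw [Matrix.sub_apply, Matrix.add_apply, vecMulVec_apply, vecMulVec_apply, vecMulVec_apply,
    vecMulVec_apply, e, es, e, es, star_one, star_neg, star_one]
  linear_combination (2 * (ket (constLabel N false) x * ket (constLabel N true) y +
    ket (constLabel N true) x * ket (constLabel N false) y)) * hc

/-- `|⟨a|b⟩|² = |⟨b|a⟩|²`. [folklore] -/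
private theorem normSq_star_dotProduct_comm (a b : (Fin N → Bool) → ℂ) :
    Complex.normSq (star a ⬝ᵥ b) = Complex.normSq (star b ⬝ᵥ a) := by
  rw [star_dotProduct, Complex.star_def, Complex.normSq_conj]

/-- **`⟨ψ|M_N|ψ⟩ = |⟨GHZ_N|ψ⟩|² − |⟨GHZ_N^−|ψ⟩|²`** (`N ≥ 1`). [cite: TothGuhne2005Stabilizer,
Theorem 4 (proof)] -/
theorem vecState_merminOp_eq_sub [NeZero N] (ψ : (Fin N → Bool) → ℂ) :
    vecState ψ (merminOp N) =
      Complex.normSq (star (ghzN N) ⬝ᵥ ψ) - Complex.normSq (star (ghzPhase N (-1)) ⬝ᵥ ψ) := by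
  have h := congrArg (fun M => vecState ψ M) (ghzProj_sub_merminOp (N := N))
  simp only [map_sub, vecState_vecMulVec] at h
  rw [normSq_star_dotProduct_comm (ghzN N), normSq_star_dotProduct_comm (ghzPhase N (-1))]
  linarith

/-- **`⟨ψ|M_N|ψ⟩ ≤ |⟨GHZ_N|ψ⟩|²`** (“`|GHZ_N⟩⟨GHZ_N| − M_N = |GHZ_N^−⟩⟨GHZ_N^−| ≥ 0`”).
[cite: TothGuhne2005Stabilizer, Theorem 4 (proof)] -/
theorem vecState_merminOp_le [NeZero N] (ψ : (Fin N → Bool) → ℂ) :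
    vecState ψ (merminOp N) ≤ Complex.normSq (star (ghzN N) ⬝ᵥ ψ) := by
  rw [vecState_merminOp_eq_sub]
  linarith [Complex.normSq_nonneg (star (ghzPhase N (-1)) ⬝ᵥ ψ)]

/-- **Theorem 4 (Tóth–Gühne 2005).** For the Bell operator `M_N` of Mermin's inequality,
`⟨M_N⟩_ϱ ≤ ⟨|GHZ_N⟩⟨GHZ_N|⟩_ϱ ≤ 1/2` for every biseparable `ϱ` (`N ≥ 1`).
[cite: TothGuhne2005Stabilizer, Theorem 4] -/
theorem tothGuhne_theorem4 [NeZero N] {ρ : Matrix (Fin N → Bool) (Fin N → Bool) ℂ}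
    (hρ : IsBiseparable ρ) : trState ρ (merminOp N) ≤ 1 / 2 := by
  obtain ⟨ι, _, p, ψ, hp, h1, hunit, hψ, rfl⟩ := hρ
  rw [trState_mixture]
  calc ∑ i, p i * vecState (ψ i) (merminOp N) ≤ ∑ i, p i * (1 / 2) := by
        refine Finset.sum_le_sum fun i _ => mul_le_mul_of_nonneg_left ?_ (hp i)
        have h := normSq_ghzN_overlap_le_of_isBiseparablePure (hψ i)
        rw [hunit i, Complex.one_re, mul_one] at h
        exact (vecState_merminOp_le (ψ i)).trans h
    _ = 1 / 2 := by rw [← Finset.sum_mul, h1, one_mul]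

/-- **GME from a Mermin violation**: `⟨M_N⟩_ϱ > 1/2 ⟹ ϱ` is genuinely `N`-partite entangled
(not biseparable). [cite: TothGuhne2005Stabilizer, Theorem 4] -/
theorem not_isBiseparable_of_half_lt_merminOp [NeZero N] {ρ : Matrix (Fin N → Bool) (Fin N → Bool) ℂ}
    (h : 1 / 2 < trState ρ (merminOp N)) : ¬ IsBiseparable ρ :=
  fun hρ => absurd h (not_lt.2 (tothGuhne_theorem4 hρ))

/-- `⟨GHZ_N|M_N|GHZ_N⟩ = 1` — “the quantum maximum is `1`”, attained (`N ≥ 1`).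
[cite: TothGuhne2005Stabilizer, Theorem 4] -/
theorem vecState_merminOp_ghzN [NeZero N] : vecState (ghzN N) (merminOp N) = 1 := by
  rw [vecState_merminOp_eq_sub, ghzN_norm, map_one]
  have h : star (ghzPhase N (-1)) ⬝ᵥ ghzN N = 0 := by
    have hne := constLabel_false_ne_true (N := N)
    rw [star_ghzPhase_dotProduct, ghzN]
    simp [Pi.add_apply, Pi.smul_apply, ket_apply, hne, hne.symm]
  rw [h, map_zero, sub_zero]

/-- `⟨ψ|M_N|ψ⟩ ≤ 1` on unit vectors — the quantum maximum `1` (`N ≥ 1`).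
[cite: TothGuhne2005Stabilizer, Theorem 4 (“while the quantum maximum is 1”)] -/
theorem vecState_merminOp_le_one [NeZero N] {ψ : (Fin N → Bool) → ℂ} (hψ : star ψ ⬝ᵥ ψ = 1) :
    vecState ψ (merminOp N) ≤ 1 := by
  have hne := constLabel_false_ne_true (N := N)
  have hsum : Complex.normSq (ψ (constLabel N false)) + Complex.normSq (ψ (constLabel N true)) ≤ 1 := by
    have h := congrArg Complex.re hψ
    rw [star_dotProduct_self_re, Complex.one_re] at h
    rw [← h, ← Finset.sum_pair (f := fun x => Complex.normSq (ψ x)) hne]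
    exact Finset.sum_le_sum_of_subset_of_nonneg (Finset.subset_univ _)
      fun x _ _ => Complex.normSq_nonneg _
  rw [vecState_merminOp]
  have h2 : 2 * (star (ψ (constLabel N false)) * ψ (constLabel N true)).re ≤
      Complex.normSq (ψ (constLabel N false)) + Complex.normSq (ψ (constLabel N true)) := by
    rw [Complex.star_def, Complex.mul_re, Complex.conj_re, Complex.conj_im, Complex.normSq_apply,
      Complex.normSq_apply]
    nlinarith [sq_nonneg ((ψ (constLabel N false)).re - (ψ (constLabel N true)).re),
      sq_nonneg ((ψ (constLabel N false)).im - (ψ (constLabel N true)).im)]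
  linarith

/-- **`Tr(|GHZ_N⟩⟨GHZ_N| M_N) = 1`**: the GHZ state attains the quantum maximum.
[cite: TothGuhne2005Stabilizer, Theorem 4] -/
theorem trState_merminOp_ghz [NeZero N] :
    trState (vecMulVec (ghzN N) (star (ghzN N))) (merminOp N) = 1 := by
  rw [trState_vecMulVec, vecState_merminOp_ghzN]

end MerminOperator

/-! ## The two-setting fidelity estimate `F ≥ Tr(P'ϱ)` (Tóth–Gühne 2005 §III.C; Gühne–Tóth (148)) -/

section FidelityBound

/-- **`P' := ½ − ½𝒲_{GHZ_N} = (S₁ + 𝟙)/2 + Π_{k=2}^N (S_k + 𝟙)/2 − 𝟙`**, measurable with the two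
settings `σ_x^{⊗N}` and `σ_z^{⊗N}` (“Note that for measuring `P'` only two local measurement settings
are needed”). [cite: TothGuhne2005Stabilizer, §III.C (“`P' := ½ − ½𝒲_{GHZ_N} = (S₁+𝟙)/2 +
Π_{k=2}^N (S_k+𝟙)/2 − 𝟙`”); GuhneToth2009, §6.6.4 eq. (148)] -/
noncomputable def fidBound (N : ℕ) : Matrix (Fin N → Bool) (Fin N → Bool) ℂ :=
  projX N + projEq N - 1

/-- `P' = ½𝟙 − ½𝒲_{GHZ_N}` with `𝒲_{GHZ_N} = 3·𝟙 − 2[(S₁+𝟙)/2 + Π(S_k+𝟙)/2]` (`tgWitness`).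
[cite: TothGuhne2005Stabilizer, §III.C] -/
theorem fidBound_eq : fidBound N =
    (1 / 2 : ℝ) • (1 : Matrix (Fin N → Bool) (Fin N → Bool) ℂ) - (1 / 2 : ℝ) • tgWitness N := by
  rw [fidBound, tgWitness]
  module

/-- **`Tr(P'ϱ)` in measured quantities**: `Tr(ϱ(S₁+𝟙)/2) + Tr(ϱ Π(S_k+𝟙)/2) − Tr ϱ` — the `σ_x^{⊗N}`
correlator term and the populations `P = ϱ_{0…0,0…0} + ϱ_{1…1,1…1}` (`trState_projX`,
`trState_projEq`). [cite: TothGuhne2005Stabilizer, §III.C] -/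
theorem trState_fidBound (ρ : Matrix (Fin N → Bool) (Fin N → Bool) ℂ) :
    trState ρ (fidBound N) = trState ρ (projX N) + trState ρ (projEq N) - ρ.trace.re := by
  rw [fidBound, map_sub, map_add, trState_one]

/-- **The operator inequality `|GHZ_N⟩⟨GHZ_N| ≥ P'`, on vectors**: `⟨ψ|P'|ψ⟩ ≤ |⟨GHZ_N|ψ⟩|²` for
every `ψ` (`N ≥ 1`; it is `𝒲 − 2𝒲̃ ≥ 0`, `vecState_tgWitness_ge`). [cite: TothGuhne2005Stabilizer,
§III.C (“`|GHZ_N⟩⟨GHZ_N| ≥ ½ − ½𝒲_{GHZ_N}`”); GuhneToth2009, §6.6.4 eq. (148)] -/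
theorem vecState_fidBound_le [NeZero N] (ψ : (Fin N → Bool) → ℂ) :
    vecState ψ (fidBound N) ≤ Complex.normSq (star (ghzN N) ⬝ᵥ ψ) := by
  have h := vecState_tgWitness_ge ψ
  rw [vecState_tgWitness] at h
  rw [fidBound, map_sub, map_add, vecState_one]
  linarith

/-- **`F ≥ F' := Tr(P'ϱ)`: the two-setting lower bound on the GHZ fidelity** for every state written
as a mixture `ϱ = Σ_i p_i|ψ_i⟩⟨ψ_i|`, `p_i ≥ 0` (e.g. its spectral decomposition).
[cite: TothGuhne2005Stabilizer, §III.C (“a lower bound on the fidelity … can be obtained as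
`F' := Tr(P'ϱ)`”); GuhneToth2009, §6.6.4 (“`F_{GHZ_N} ≥ (1 − ⟨𝒲̃_{GHZ_N}⟩)/2`”)] -/
theorem trState_fidBound_le_ghzFidelity [NeZero N] {ι : Type*} [Fintype ι] {p : ι → ℝ}
    (hp : ∀ i, 0 ≤ p i) (ψ : ι → (Fin N → Bool) → ℂ) :
    trState (∑ i, (p i : ℂ) • vecMulVec (ψ i) (star (ψ i))) (fidBound N) ≤
      ghzFidelity (∑ i, (p i : ℂ) • vecMulVec (ψ i) (star (ψ i))) := by
  rw [trState_mixture, ghzFidelity, vecState_sum_smul_vecMulVec]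
  exact Finset.sum_le_sum fun i _ => mul_le_mul_of_nonneg_left (vecState_fidBound_le (ψ i)) (hp i)

/-- `Tr ϱ(p) = 1` for the noisy GHZ state (`N ≥ 1`). [cite: TothGuhne2005Stabilizer, Definition 2] -/
theorem trace_noisyGHZ [NeZero N] (p : ℝ) : (noisyGHZ N p).trace = 1 := by
  rw [noisyGHZ, trace_add, trace_smul, trace_smul, trace_one_register, trace_vecMulVec,
    dotProduct_comm, ghzN_norm, smul_eq_mul, smul_eq_mul, mul_one]
  have hpos : (2 : ℂ) ^ N ≠ 0 := pow_ne_zero _ two_ne_zero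
  push_cast
  field_simp
  ring

/-- **`F'(p_noise) = 1 − p_noise(3/2 − 2^{−(N−1)})`** on `ϱ(p_noise)` (`N ≥ 1`).
[cite: TothGuhne2005Stabilizer, §III.C] -/
theorem trState_fidBound_noisyGHZ [NeZero N] (p : ℝ) :
    trState (noisyGHZ N p) (fidBound N) = 1 - p * (3 / 2 - 2 / 2 ^ N) := by
  rw [fidBound_eq, map_sub, map_smul, map_smul, trState_one, trState_tgWitness_noisyGHZ,
    trace_noisyGHZ, Complex.one_re, smul_eq_mul, smul_eq_mul]
  ring

/-- The two parametrisations of the noisy GHZ state in the tree agree: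
`noisyGHZ N p = ghzWhiteNoise N p`. [cite: TothGuhne2005Stabilizer, Definition 2; GuhneToth2009,
§6.3.1 eq. (129)] -/
theorem noisyGHZ_eq_ghzWhiteNoise (p : ℝ) : noisyGHZ N p = ghzWhiteNoise N p := by
  rw [noisyGHZ, ghzWhiteNoise, add_comm]
  ext x y
  simp only [Matrix.add_apply, Matrix.smul_apply, smul_eq_mul, Complex.real_smul]

/-- **`F(p_noise) = 1 − p_noise(1 − 2^{−N})`** (`N ≥ 1`). [cite: TothGuhne2005Stabilizer, §III.C] -/
theorem ghzFidelity_noisyGHZ [NeZero N] (p : ℝ) :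
    ghzFidelity (noisyGHZ N p) = 1 - p * (1 - 1 / 2 ^ N) := by
  rw [noisyGHZ_eq_ghzWhiteNoise, ghzFidelity_ghzWhiteNoise]; ring

/-- **`ΔF = F − F' = p_noise(½ − 2^{−N})`** (“The difference is `ΔF ≈ p_noise/2` for large `N`”).
[cite: TothGuhne2005Stabilizer, §III.C] -/
theorem ghzFidelity_sub_fidBound_noisyGHZ [NeZero N] (p : ℝ) :
    ghzFidelity (noisyGHZ N p) - trState (noisyGHZ N p) (fidBound N) = p * (1 / 2 - 1 / 2 ^ N) := by
  rw [ghzFidelity_noisyGHZ, trState_fidBound_noisyGHZ]; ring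

/-- On `ϱ(p_noise)` the bound is indeed below the fidelity: `F' ≤ F` (`N ≥ 1`, `p_noise ≥ 0`).
[cite: TothGuhne2005Stabilizer, §III.C] -/
theorem trState_fidBound_noisyGHZ_le [NeZero N] {p : ℝ} (hp : 0 ≤ p) :
    trState (noisyGHZ N p) (fidBound N) ≤ ghzFidelity (noisyGHZ N p) := by
  have h := ghzFidelity_sub_fidBound_noisyGHZ (N := N) p
  have h2 : (1 : ℝ) / 2 ^ N ≤ 1 / 2 := by
    have h3 : (2 : ℝ) ≤ 2 ^ N := by
      calc (2 : ℝ) = 2 ^ 1 := by norm_num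
        _ ≤ 2 ^ N := pow_le_pow_right₀ (by norm_num) (Nat.one_le_iff_ne_zero.mpr (NeZero.ne N))
    exact one_div_le_one_div_of_le (by norm_num) h3
  nlinarith

end FidelityBound

/-! ## (v5) The GHZ state is uniquely defined by `S_k|GHZ_N⟩ = |GHZ_N⟩`; `|GHZ_N⟩⟨GHZ_N| = Π_k(S_k+𝟙)/2`

Tóth–Gühne 2005 §II: “Besides this explicit definition one may define the GHZ state also in the
following way: … `S_1^{(GHZ_N)} := Π_{k=1}^N X^{(k)}`, `S_k^{(GHZ_N)} := Z^{(k−1)}Z^{(k)}` for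
`k = 2, 3, …, N` … Now we can define the GHZ state as the state `|GHZ_N⟩` which fulfills
`S_k^{(GHZ_N)}|GHZ_N⟩ = |GHZ_N⟩` for `k = 1, 2, …, N`. One can straightforwardly calculate that these
definitions are equivalent and the GHZ state is uniquely defined by [these equations].”  Gühne–Tóth
2009 §6.6.1 eqs. (137)–(138): “the projector to `|Ψ⟩` can be written as
`|Ψ⟩⟨Ψ| = 2^{−N} Σ_k S_k = Π_{k=1}^N (𝟙 + g_k)/2`” with “`g_1^{(GHZ_N)} := Π_k X_k`,
`g_k^{(GHZ_N)} := Z_{k−1}Z_k`”.  (The converse direction, `S_k|GHZ_N⟩ = |GHZ_N⟩`, is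
`stabX_mulVec_ghzN` / `stabZZ_mulVec_ghzN` above.) -/

section Uniqueness

/-- `S₁ψ = ψ ⟹ (S₁+𝟙)/2 ψ = ψ`. [cite: TothGuhne2005Stabilizer, §II eq. (3)] -/
theorem projX_mulVec_of_stabX {ψ : (Fin N → Bool) → ℂ} (h : stabX N *ᵥ ψ = ψ) :
    projX N *ᵥ ψ = ψ := by
  rw [projX, Matrix.smul_mulVec, add_mulVec, one_mulVec, h]
  funext x
  rw [Pi.smul_apply, Pi.add_apply, Complex.real_smul]
  push_cast
  ring

/-- `S_kψ = ψ` for `k = 2, …, N ⟹ Π_k(S_k+𝟙)/2 ψ = ψ`: a common `+1` eigenvector of the `Z^{(k−1)}Z^{(k)}`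
is supported on the constant strings. [cite: TothGuhne2005Stabilizer, §II eq. (3); GuhneToth2009,
§6.6.1 eq. (138)] -/
theorem projEq_mulVec_of_stabZZ {n : ℕ} {ψ : (Fin (n + 1) → Bool) → ℂ}
    (h : ∀ i : Fin n, stabZZ i *ᵥ ψ = ψ) : projEq (n + 1) *ᵥ ψ = ψ := by
  funext x
  rw [projEq, mulVec_diagonal]
  by_cases hc : ∀ i j, x i = x j
  · rw [if_pos hc, one_mul]
  · rw [if_neg hc, zero_mul]
    obtain ⟨i, hi⟩ : ∃ i : Fin n, x i.castSucc ≠ x i.succ := by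
      by_contra hall; push Not at hall; exact hc ((const_iff_chain x).2 hall)
    have hx := congrFun (h i) x
    rw [stabZZ_eq_diagonal, mulVec_diagonal, if_neg hi] at hx
    have h2 : (2 : ℂ) * ψ x = 0 := by linear_combination (-1 : ℂ) * hx
    exact ((mul_eq_zero.mp h2).resolve_left two_ne_zero).symm

/-- **`(S₁+𝟙)/2 · Π_{k=2}^N (S_k+𝟙)/2 = |GHZ_N⟩⟨GHZ_N|`** (`N ≥ 1`) — the projector onto the GHZ state
as the product of its commuting generator projectors, eq. (137) with the generators (138).
[cite: GuhneToth2009, §6.6.1 eqs. (137)–(138); TothGuhne2005Stabilizer, §II eq. (3)] -/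
theorem projX_mul_projEq [NeZero N] :
    projX N * projEq N = vecMulVec (ghzN N) (star (ghzN N)) := by
  have hne := constLabel_false_ne_true (N := N)
  have hc : ((1 / 2 : ℝ) : ℂ) = (CHSHOpt.invSqrtTwo : ℂ) * (CHSHOpt.invSqrtTwo : ℂ) := by
    rw [← Complex.ofReal_mul, CHSHOpt.invSqrtTwo_mul_self]
  have eg : ∀ z : Fin N → Bool, ghzN N z =
      (CHSHOpt.invSqrtTwo : ℂ) * (ket (constLabel N false) z + ket (constLabel N true) z) := by
    intro z; simp [ghzN]
  have egs : ∀ z : Fin N → Bool, star (ghzN N) z =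
      (CHSHOpt.invSqrtTwo : ℂ) * (ket (constLabel N false) z + ket (constLabel N true) z) := by
    intro z
    have h0 := congrFun (star_ket (constLabel N false)) z
    have h1 := congrFun (star_ket (constLabel N true)) z
    rw [Pi.star_apply] at h0 h1
    rw [Pi.star_apply, eg, star_mul', star_add, h0, h1, Complex.star_def, Complex.conj_ofReal]
  -- `constLabel b = x̄ ↔ x = constLabel (¬b)`
  have hflip : ∀ (b : Bool) (x : Fin N → Bool),
      constLabel N b = flipAll x ↔ x = constLabel N (!b) := by
    intro b x
    constructor
    · intro h; rw [← flipAll_flipAll x, ← h, flipAll_constLabel]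
    · intro h; rw [h, flipAll_constLabel, Bool.not_not]
  have hconst : ∀ b : Bool, ∀ i j : Fin N, constLabel N b i = constLabel N b j := fun _ _ _ => rfl
  ext x y
  rw [projX, Matrix.smul_mul, Matrix.add_mul, Matrix.one_mul, Matrix.smul_apply, Matrix.add_apply,
    projEq, mul_diagonal, Matrix.diagonal_apply, stabX_apply, vecMulVec_apply, eg, egs,
    Complex.real_smul, hc, ket_apply, ket_apply, ket_apply, ket_apply]
  by_cases hyc : ∀ i j, y i = y j
  · rw [if_pos hyc, mul_one]
    rcases (const_iff_eq_constLabel y).1 hyc with rfl | rfl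
    · -- `y = |0…0⟩`
      rw [if_pos rfl, if_neg hne]
      by_cases h1 : x = constLabel N true
      · rw [if_pos ((hflip false x).2 h1), if_neg (fun h => hne (h.symm.trans h1)), if_pos h1,
          if_neg (fun h => hne (h.symm.trans h1))]
        ring
      · rw [if_neg (fun h => h1 ((hflip false x).1 h)), if_neg h1]
        by_cases h0 : x = constLabel N false
        · rw [if_pos h0, if_pos h0, h0, if_pos (hconst false)]; ring
        · rw [if_neg h0, if_neg h0]; ring
    · -- `y = |1…1⟩`
      rw [if_neg hne.symm, if_pos rfl]
      by_cases h0 : x = constLabel N false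
      · rw [if_pos ((hflip true x).2 h0), if_pos h0, if_neg (fun h => hne (h0.symm.trans h)),
          if_neg (fun h => hne (h0.symm.trans h))]
        ring
      · rw [if_neg (fun h => h0 ((hflip true x).1 h)), if_neg h0]
        by_cases h1 : x = constLabel N true
        · rw [if_pos h1, if_pos h1, h1, if_pos (hconst true)]; ring
        · rw [if_neg h1, if_neg h1]; ring
  · rw [if_neg hyc, mul_zero, if_neg (fun h => hyc ((const_iff_eq_constLabel y).2 (Or.inl h))),
      if_neg (fun h => hyc ((const_iff_eq_constLabel y).2 (Or.inr h)))]
    by_cases hxy : x = y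
    · subst hxy; rw [if_pos rfl, if_neg hyc]; ring
    · rw [if_neg hxy]; ring

/-- **The GHZ state is uniquely defined by `S_k|GHZ_N⟩ = |GHZ_N⟩`, `k = 1, …, N`**: a common `+1`
eigenvector of `S₁ = X^{⊗N}` and of the chain `S_k = Z^{(k−1)}Z^{(k)}` (equivalently of
`Π_k(S_k+𝟙)/2`) is a multiple of `|GHZ_N⟩`: `ψ = ⟨GHZ_N|ψ⟩|GHZ_N⟩` (`N ≥ 1`).
[cite: TothGuhne2005Stabilizer, §II (“these definitions are equivalent and the GHZ state is uniquely
defined by the Eqs. (3)”)] -/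
theorem ghz_unique [NeZero N] {ψ : (Fin N → Bool) → ℂ} (hX : stabX N *ᵥ ψ = ψ)
    (hE : projEq N *ᵥ ψ = ψ) : ψ = (star (ghzN N) ⬝ᵥ ψ) • ghzN N := by
  have h1 : (projX N * projEq N) *ᵥ ψ = ψ := by
    rw [← mulVec_mulVec, hE, projX_mulVec_of_stabX hX]
  rw [projX_mul_projEq] at h1
  have h2 : vecMulVec (ghzN N) (star (ghzN N)) *ᵥ ψ = (star (ghzN N) ⬝ᵥ ψ) • ghzN N := by
    ext i
    simp [mulVec, dotProduct, vecMulVec_apply, Finset.mul_sum, mul_comm, mul_left_comm]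
  rw [h2] at h1
  exact h1.symm

/-- The same with the generators `S_k = Z^{(k−1)}Z^{(k)}` themselves (`N = n + 1`).
[cite: TothGuhne2005Stabilizer, §II eq. (3)] -/
theorem ghz_unique_of_stabZZ {n : ℕ} {ψ : (Fin (n + 1) → Bool) → ℂ} (hX : stabX (n + 1) *ᵥ ψ = ψ)
    (hZ : ∀ i : Fin n, stabZZ i *ᵥ ψ = ψ) : ψ = (star (ghzN (n + 1)) ⬝ᵥ ψ) • ghzN (n + 1) :=
  ghz_unique hX (projEq_mulVec_of_stabZZ hZ)

/-- Hence a unit common eigenvector has GHZ fidelity `|⟨GHZ_N|ψ⟩|² = 1`. [cite: TothGuhne2005Stabilizer,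
§II (“uniquely determined by the fact that it exhibits perfect correlations for the observables
`S_k^{(GHZ_N)}`”)] -/
theorem normSq_ghz_overlap_eq_one [NeZero N] {ψ : (Fin N → Bool) → ℂ} (hX : stabX N *ᵥ ψ = ψ)
    (hE : projEq N *ᵥ ψ = ψ) (hψ : star ψ ⬝ᵥ ψ = 1) : Complex.normSq (star (ghzN N) ⬝ᵥ ψ) = 1 := by
  have h1 := ghz_unique hX hE
  have h2 : star ψ ⬝ᵥ ψ = Complex.normSq (star (ghzN N) ⬝ᵥ ψ) := by
    conv_lhs => rw [h1]
    rw [star_smul, smul_dotProduct, dotProduct_smul, ghzN_norm, smul_eq_mul, smul_eq_mul, mul_one,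
      Complex.star_def, Complex.normSq_eq_conj_mul_self]
  rw [← Complex.ofReal_inj, ← h2, hψ, Complex.ofReal_one]

end Uniqueness

/-! ## (v6) The Mermin witness `𝒲_Mermin` (Gühne–Tóth 2009, eq. (141))

“Let us consider the following witness `𝒲_Mermin := 2^{N−2}𝟙 − Σ_π X₁X₂X₃X₄⋯X_N + Σ_π Y₁Y₂X₃X₄⋯X_N
− Σ_π Y₁Y₂Y₃Y₄X₅⋯X_N + … − …` (141), where `Σ_π` indicates that every term represents the sum of all
of its permutations. This witness is just constructed from the Bell operator of the Mermin inequality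
… We used the bound for genuine multipartite entanglement for this inequality … Thus, `𝒲_Mermin`
detects genuine multipartite entanglement. Note that the witness is also a stabilizer witness since
all the terms in Eq. (141) are stabilizing operators of the GHZ state. This witness detects the noisy
GHZ state as entangled if `p_noise < 1/2`.”  With section `MerminOperator`: the word sum is
`2^{N−1}M_N`, so `𝒲_Mermin = 2^{N−1}(½𝟙 − M_N)` and Theorem 4 (`⟨M_N⟩ ≤ ½` on biseparable states)
is exactly its witness property. -/

section MerminWitness

/-- The word sum of (141): `X⋯X − Σ YYX⋯X + Σ YYYYX⋯X − … = 2^{N−1} M_N`.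
[cite: GuhneToth2009, §6.6.1 eq. (141); TothGuhne2005Stabilizer, Theorem 4] -/
theorem sum_merminCoeff_smul_obsWord (N : ℕ) :
    ∑ s : Fin N → Bool, merminCoeff s • obsWord s = ((2 : ℝ) ^ (N - 1)) • merminOp N := by
  have h : ((2 : ℝ) ^ (N - 1)) • merminOp N = ((2 : ℂ) ^ (N - 1)) • merminOp N := by
    ext x y; simp [Matrix.smul_apply, Complex.real_smul]
  rw [h, merminOp, smul_smul, mul_inv_cancel₀ (pow_ne_zero _ two_ne_zero), one_smul]

/-- **`𝒲_Mermin := 2^{N−2}𝟙 − [X⋯X − Σ_π YYX⋯X + Σ_π YYYYX⋯X − …]`** (141), written as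
`2^{N−1}(½𝟙 − M_N)`; the printed word-sum form is `merminWitness_eq_wordSum`.
[cite: GuhneToth2009, §6.6.1 eq. (141)] -/
noncomputable def merminWitness (N : ℕ) : Matrix (Fin N → Bool) (Fin N → Bool) ℂ :=
  ((2 : ℝ) ^ (N - 1) / 2) • (1 : Matrix (Fin N → Bool) (Fin N → Bool) ℂ) -
    ((2 : ℝ) ^ (N - 1)) • merminOp N

/-- The printed form: `𝒲_Mermin = 2^{N−2}𝟙 − Σ_s Re(i^{#y(s)}) O_s` (the `σ_x/σ_y` word sum with the
signs `+, 0, −, 0` by `#y mod 4`). [cite: GuhneToth2009, §6.6.1 eq. (141)] -/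
theorem merminWitness_eq_wordSum (N : ℕ) :
    merminWitness N = ((2 : ℝ) ^ (N - 1) / 2) • (1 : Matrix (Fin N → Bool) (Fin N → Bool) ℂ) -
      ∑ s : Fin N → Bool, merminCoeff s • obsWord s := by
  rw [merminWitness, sum_merminCoeff_smul_obsWord]

/-- `Tr(ϱ𝒲_Mermin) = 2^{N−1}(½Tr ϱ − Tr(ϱM_N))` (real parts). [cite: GuhneToth2009, §6.6.1 eq. (141)] -/
theorem trState_merminWitness (ρ : Matrix (Fin N → Bool) (Fin N → Bool) ℂ) :
    trState ρ (merminWitness N) =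
      (2 : ℝ) ^ (N - 1) * (1 / 2 * ρ.trace.re - trState ρ (merminOp N)) := by
  rw [merminWitness, map_sub, map_smul, map_smul, trState_one, smul_eq_mul, smul_eq_mul]; ring

/-- **`𝒲_Mermin` detects only genuine `N`-partite entanglement**: `Tr(ϱ𝒲_Mermin) ≥ 0` for every
biseparable `ϱ` (Theorem 4: `⟨M_N⟩_ϱ ≤ ½`; `N ≥ 1`). [cite: GuhneToth2009, §6.6.1 eq. (141) (“Thus,
`𝒲_Mermin` detects genuine multipartite entanglement”); TothGuhne2005Stabilizer, Theorem 4] -/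
theorem merminWitness_nonneg_of_isBiseparable [NeZero N] {ρ : Matrix (Fin N → Bool) (Fin N → Bool) ℂ}
    (hρ : IsBiseparable ρ) : 0 ≤ trState ρ (merminWitness N) := by
  have h := tothGuhne_theorem4 hρ
  rw [trState_merminWitness, trace_eq_one_of_isBiseparable hρ, Complex.one_re, mul_one]
  exact mul_nonneg (pow_nonneg (by norm_num) _) (by linarith)

/-- `M_N|GHZ_N⟩ = |GHZ_N⟩` (`M_N = |0…0⟩⟨1…1| + |1…1⟩⟨0…0|` swaps the two GHZ components; `N ≥ 1`).
[cite: TothGuhne2005Stabilizer, Theorem 4 (proof)] -/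
theorem merminOp_mulVec_ghzN [NeZero N] : merminOp N *ᵥ ghzN N = ghzN N := by
  have eg : ∀ z : Fin N → Bool, ghzN N z =
      (CHSHOpt.invSqrtTwo : ℂ) * (ket (constLabel N false) z + ket (constLabel N true) z) := by
    intro z; simp [ghzN]
  have hne := constLabel_false_ne_true (N := N)
  rw [merminOp_eq, add_mulVec, vecMulVec_ket_mulVec, vecMulVec_ket_mulVec]
  funext z
  rw [Pi.add_apply, Pi.smul_apply, Pi.smul_apply, smul_eq_mul, smul_eq_mul, eg, eg, eg,
    ket_apply, ket_apply, ket_apply, ket_apply, ket_apply, ket_apply, if_neg hne.symm, if_pos rfl,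
    if_pos rfl, if_neg hne]
  ring

/-- `Tr M_N = 0` (`N ≥ 1`). [cite: TothGuhne2005Stabilizer, Theorem 4 (`M_N = |0…0⟩⟨1…1| + |1…1⟩⟨0…0|`)] -/
theorem trace_merminOp [NeZero N] : (merminOp N).trace = 0 := by
  have hne := constLabel_false_ne_true (N := N)
  rw [merminOp_eq, trace_add, trace_vecMulVec, trace_vecMulVec, dotProduct_ket, dotProduct_ket,
    ket_apply, ket_apply, if_neg hne.symm, if_neg hne, add_zero]

/-- `Tr 𝒲_Mermin = 2^{N−1}·2^N/2` (`N ≥ 1`). [cite: GuhneToth2009, §6.6.1 eq. (141)] -/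
theorem trace_merminWitness [NeZero N] :
    (merminWitness N).trace = (((2 : ℝ) ^ (N - 1) / 2 * 2 ^ N : ℝ) : ℂ) := by
  rw [merminWitness, trace_sub, trace_smul, trace_smul, trace_one_register, trace_merminOp, smul_zero,
    sub_zero, Complex.real_smul]
  push_cast; ring

/-- **`Tr(𝒲_Mermin ϱ(p)) = 2^{N−1}(p − ½)`** on the noisy GHZ state (`N ≥ 1`).
[cite: GuhneToth2009, §6.6.1 eq. (141)] -/
theorem trState_merminWitness_noisyGHZ [NeZero N] (p : ℝ) :
    trState (noisyGHZ N p) (merminWitness N) = (2 : ℝ) ^ (N - 1) * (p - 1 / 2) := by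
  have hM : trState (noisyGHZ N p) (merminOp N) = 1 - p := by
    rw [trState_apply, noisyGHZ, Matrix.add_mul, Matrix.smul_mul, Matrix.smul_mul, Matrix.one_mul,
      trace_add, trace_smul, trace_smul, trace_merminOp, smul_zero, zero_add, Matrix.trace_mul_comm,
      Matrix.mul_vecMulVec, merminOp_mulVec_ghzN, trace_vecMulVec, dotProduct_comm, ghzN_norm,
      smul_eq_mul, mul_one, Complex.ofReal_re]
  have hT : (noisyGHZ N p).trace.re = 1 := by rw [trace_noisyGHZ, Complex.one_re]
  rw [trState_merminWitness, hM, hT]; ring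

/-- **“This witness detects the noisy GHZ state as entangled if `p_noise < 1/2`”** (and only then;
`N ≥ 1`). [cite: GuhneToth2009, §6.6.1 eq. (141)] -/
theorem merminWitness_detects_noisyGHZ [NeZero N] (p : ℝ) :
    trState (noisyGHZ N p) (merminWitness N) < 0 ↔ p < 1 / 2 := by
  rw [trState_merminWitness_noisyGHZ]
  have hpos : (0 : ℝ) < 2 ^ (N - 1) := pow_pos (by norm_num) _
  constructor
  · intro h; nlinarith
  · intro h; nlinarith

end MerminWitness

end GHZStabilizerWitness

end Literature.InformationTheory.Entanglement
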